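import Mathlib
import Literature.Computability.Complexity.Mod2SymmetricPseudoexpectationHonest
import HarnessLib

/-!
# The symmetric pseudo-matching functional of `K_N` — Part C: interpolation to odd `N`, positivity of
# the outcome probabilities, and the PSD theorem (`6k ≤ N`)

Continuation of `Mod2SymmetricPseudoexpectation.lean` (Part A: statement, symmetry reduction, outcomes)
and `Mod2SymmetricPseudoexpectationHonest.lean` (Part B: the honest worlds `K_m`, `m` even).  Source:
A. Potechin, *Sum of squares lower bounds from symmetry and a good story*, ITCS 2019, LIPIcs 124:61,
arXiv:1711.11469 [Potechin2019] — Theorem 1.2 («Degree (n−1)/2 SOS fails to prove that the equations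
for the MOD 2 principle are infeasible», 61:4; with Def. 2.14 this says: for odd `n` the story
pseudo-expectation `Ẽ` of Example 3.4 satisfies `Ẽ[g²] ≥ 0` for every `g` of index degree `≤ n/2`),
proved there by the strategy of §5 (Thm 5.11/5.12: condition on the outcome inside the index set `I`
of one coefficient and use the symmetry under `S_{[n] ∖ I}`) and §6 (the story with a free size
parameter and polynomial interpolation in the number of vertices: Def. 6.1–6.5, Lemma 6.7, Thm 6.8).

## Result

**`storyForm_nonneg`**: for odd `N` and `6k ≤ N`, the story pseudo-expectation
`Ẽ[x_G] = [G partial matching] · ∏_{j<|G|} (N − 1 − 2j)⁻¹` of the MOD 2 principle on `K_N` satisfies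
`Σ_{A,B : |A|,|B| ≤ k} δ_A δ_B Ẽ[x_{A ∪ B}] ≥ 0` for every real coefficient vector `δ` indexed by edge
sets of size `≤ k` (i.e. `Ẽ[g²] ≥ 0` for multilinear `g` of edge-degree `≤ k`);
**`pseudoMatching_momentForm_nonneg`** is the same statement with the kernel spelled
`[A ∪ B p.m.] · (∏_{j<|A ∪ B|} (N − 1 − 2j))⁻¹`.  Potechin's printed range is index degree `≤ n/2`,
which contains edge-degree `k` for `4k + 1 ≤ n`; the argument formalised in Parts A–C closes the proof
in the range `6k ≤ N` (see *Threshold*), still linear in `N`, which is what the `Ω(n)`-degree lower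
bound for MOD 2 / perfect matching (Grigoriev [Grigoriev2001TCS]; Potechin, Thm 1.2) expresses.

## Proof (Parts A–C)

1. (Part A §4–§6; Thm 4.1 / Cor 4.2) Averaging a minimal eigenvector over the pointwise stabiliser of
   the vertex set `I` (`|I| ≤ 2k`) of one index, it suffices to prove `Ẽ[g²] ≥ 0` for `g` with
   `stab I`-invariant coefficients (`storyForm_nonneg_of_invariant`).
2. (Part A §7; Def 5.2, Thm 5.12 (2)) Expand `Ẽ[g²] = Σ_{F ⊆ E(I)} Ẽ[g² 1_F]` over the outcomes `F`
   inside `I` (`sum_outcomeValue`); outcomes that are not partial matchings contribute `0`.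
3. (Part B and §C1–§C6; Prop 5.7, Lemma 6.7, Thm 6.8) **Conditioned multiplicativity**
   `outcomeValue_mul_sum_odd`: `Ẽ[1_F] · Σ_{σ ∈ stab I} Ẽ[x_A x_{σB} 1_F] = #stab I · Ẽ[x_A 1_F] · Ẽ[x_B 1_F]`
   whenever the supports fit, `|I| + |V(A) ∖ I| + |V(B) ∖ I| ≤ N`.  In an honest world `K_m`
   (`m ≥ N` even, `K_N ⊆ K_m`) this is Part B's single-orbit identity `outcomeValue_mul_sum_honest`;
   both sides times the common denominator `D_J(m)² = ∏_{j<J} (m − 1 − 2j)²` are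
   `(m − |I| − t)! · (polynomial in m)` uniformly in the world (`wsum_poly`, from the vertex-exposure
   recursion `wsum_recursion` for stabiliser sums), so the resulting polynomial identity, valid at
   every even `m ≥ N`, holds at `m = N` (`Polynomial.eq_zero_of_infinite_isRoot`).
4. (§C7; Thm 5.12 (2): «`E''` has all non-negative probabilities») **Positivity**
   `outcomeValue_empty_pos`: `Ẽ[1_F] = (N − |I|)(N − |I| − 1)⋯(N − 2|I| + 2|F| + 1) · μ_N(|I| − |F|) > 0`
   for `2|I| ≤ N` (closed form by vertex exposure: `noEdgeVal_insert`, `noEdgeVal_eq_neClosed`).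
5. (§C8) For invariant `v`: `Ẽ[1_F] · Ẽ[g² 1_F] = (Σ_A v_A Ẽ[x_A 1_F])² ≥ 0` by 3. averaged over
   `stab I`, hence `Ẽ[g² 1_F] ≥ 0` by 4., and `Ẽ[g²] = Σ_F Ẽ[g² 1_F] ≥ 0`.

## Threshold

Potechin's Lemma 5.13 (61:13) asserts the per-outcome multiplicativity for every symmetric `g` of index
degree `≤ n/2`; step 3 proves it when the supports fit, `|I| + |V(A) ∖ I| + |V(B) ∖ I| ≤ N`, which for
indices of edge-degree `≤ k` (`|I| ≤ 2k`, `|V(A)|, |V(B)| ≤ 2k`) is guaranteed exactly by `6k ≤ N`.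
For `4k + 1 ≤ N < 6k` the stabiliser-symmetrised products reach index degree `2k` off `I`, the fitting
can fail, and the per-outcome identity is not available in this elementary form (cf. the remarks in
Part A's docstring); the printed range would need the representation-theoretic analysis of §7–§8.
-- TODO(general form): Theorem 1.2 in the printed range `4k + 1 ≤ N` [cite: Potechin2019, Thm 1.2, §7–§8].

## Contents (all proved; no named facts)

* §C1 `pval`, `poutcome`: story and outcome values on the base `K_N` with a free size parameter `m`.
* §C2 `push`: transport of base edge sets into a world `K_m ⊇ K_N`; `storyValue_push`, `outcomeValue_push`.
* §C3 symmetries: `outcomeValue_relabel`, coset decompositions `sum_stab_eq_sum_sum`, `sum_stab_insert_conj`.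
* §C4 clearing denominators: `Dpoly`, `pvalPoly`, `poutcomePoly`, `eval_poutcomePoly`.
* §C5 stabiliser sums over a world `wsum`, the exposure recursion `wsum_recursion`, polynomiality `wsum_poly`.
* §C6 **`outcomeValue_mul_sum_odd`** (conditioned multiplicativity at the odd size `N`).
* §C7 `mval`, `noEdgeVal`, `noEdgeVal_insert`, `neClosed`, `noEdgeVal_eq_neClosed`,
  `outcomeValue_empty_eq`, **`outcomeValue_empty_pos`**.
* §C8 **`storyForm_nonneg`**, **`pseudoMatching_momentForm_nonneg`**.

## References

* A. Potechin, *Sum of squares lower bounds from symmetry and a good story*, ITCS 2019, LIPIcs 124:61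
  (arXiv:1711.11469): Thm 1.2, Def 2.14, Ex 3.4, Thm 4.1, Def 5.2, Prop 5.7, Thm 5.11–5.12,
  Lemma 5.13, §6 (Def 6.1–6.5, Lemma 6.7, Thm 6.8). [Potechin2019]
* D. Grigoriev, *Linear lower bound on degrees of Positivstellensatz calculus proofs for the parity*,
  Theoret. Comput. Sci. 259 (2001) 613–622. [Grigoriev2001TCS]
-/

noncomputable section

open Finset Matrix
open scoped BigOperators

namespace Literature.Computability.Complexity

namespace PseudoMatching

open Literature.Barriers.PneNP (IsPMOn perfectMatchings mem_perfectMatchings perfectMatchings_nonempty)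
open Literature.Combinatorics.Optimization (innerEdges mem_innerEdges)

variable {N m : ℕ}

/-! ### §C1 The story with a free size parameter, on a fixed base clique `K_N` -/

/-- Story value of a base monomial `x_G`, `G ⊆ E(K_N)`, computed with size parameter `m`:
`[G partial matching] · μ_m(|G|)` (for `m = N` this is `storyValue N G`; for a world `K_m ⊇ K_N` it is
the story value of the transported monomial). [cite: Potechin2019, §6, Def. 6.1–6.3 (61:13–61:14: "the
problem equations and S depend on a set of parameters … for the MOD 2 principle we only have the parameter n")] -/
def pval (m : ℕ) (G : Finset (Sym2 (Fin N))) : ℝ :=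
  by classical exact if IsPartialMatching G then moment m G.card else 0

/-- Outcome-restricted story value with size parameter `m` (cf. `outcomeValue`).
[cite: Potechin2019, Def. 6.3 (61:14, "Ẽ_{S,B}[p] is a rational function of the parameters")] -/
def poutcome (m : ℕ) (I : Finset (Fin N)) (F C : Finset (Sym2 (Fin N))) : ℝ :=
  ∑ S ∈ (innerEdges I \ F).powerset, (-1 : ℝ) ^ S.card * pval m (C ∪ F ∪ S)

/-- `pval` on partial matchings. [cite: Potechin2019, Example 3.4 (61:7), Def. 6.3 (61:14)] -/
theorem pval_of {G : Finset (Sym2 (Fin N))} (h : IsPartialMatching G) : pval m G = moment m G.card := by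
  classical simp [pval, h]

/-- `pval` vanishes off partial matchings. [cite: Potechin2019, Example 3.4 (61:7), Def. 6.3 (61:14)] -/
theorem pval_of_not {G : Finset (Sym2 (Fin N))} (h : ¬ IsPartialMatching G) : pval m G = 0 := by
  classical simp [pval, h]

/-- At the base parameter the parametrised values are the story values. [cite: Potechin2019, Def. 6.3 (61:14)] -/
theorem pval_self (G : Finset (Sym2 (Fin N))) : pval N G = storyValue N G := by
  by_cases h : IsPartialMatching G
  · rw [pval_of h, storyValue_of h]
  · rw [pval_of_not h, storyValue_of_not h]

/-- At the base parameter, `poutcome N = outcomeValue N`. [cite: Potechin2019, Def. 6.3 (61:14)] -/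
theorem poutcome_self (I : Finset (Fin N)) (F C : Finset (Sym2 (Fin N))) :
    poutcome N I F C = outcomeValue N I F C := by
  simp only [poutcome, outcomeValue, pval_self]

/-! ### §C2 Transport of base data into a world `K_m ⊇ K_N` -/

/-- Transport of a base edge set along a vertex embedding `e : Fin N ↪ Fin m`.
[cite: Potechin2019, Def. 6.5 (61:14, honest parameter values live on larger vertex sets)] -/
def push (e : Fin N ↪ Fin m) (A : Finset (Sym2 (Fin N))) : Finset (Sym2 (Fin m)) := A.map e.sym2Map

/-- Membership in a transported edge set. [cite: Potechin2019, Def. 6.5 (61:14)] -/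
theorem mem_push {e : Fin N ↪ Fin m} {A : Finset (Sym2 (Fin N))} {z : Sym2 (Fin m)} :
    z ∈ push e A ↔ ∃ z' ∈ A, Sym2.map e z' = z := by
  simp [push]

/-- Transport preserves the number of edges. [cite: Potechin2019, Def. 6.5 (61:14)] -/
@[simp] theorem card_push (e : Fin N ↪ Fin m) (A : Finset (Sym2 (Fin N))) : (push e A).card = A.card :=
  card_map _

/-- Transport commutes with unions. [cite: Potechin2019, Def. 6.5 (61:14)] -/
theorem push_union (e : Fin N ↪ Fin m) (A B : Finset (Sym2 (Fin N))) : push e (A ∪ B) = push e A ∪ push e B :=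
  map_union _ _

/-- Transport commutes with set differences. [cite: Potechin2019, Def. 6.5 (61:14)] -/
theorem push_sdiff (e : Fin N ↪ Fin m) (A B : Finset (Sym2 (Fin N))) : push e (A \ B) = push e A \ push e B := by
  ext z
  simp only [mem_push, mem_sdiff]
  constructor
  · rintro ⟨z', hz', rfl⟩
    exact ⟨⟨z', hz'.1, rfl⟩, fun ⟨z'', hz'', h⟩ => hz'.2 (by rwa [← Sym2.map.injective e.injective h])⟩
  · rintro ⟨⟨z', hz', rfl⟩, h2⟩
    exact ⟨z', ⟨hz', fun hB => h2 ⟨z', hB, rfl⟩⟩, rfl⟩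

/-- Transport is injective. [cite: Potechin2019, Def. 6.5 (61:14)] -/
theorem push_injective (e : Fin N ↪ Fin m) : Function.Injective (push e) := fun _ _ h => map_injective _ h

/-- Transport of the empty edge set. [cite: Potechin2019, Def. 6.5 (61:14)] -/
theorem push_empty (e : Fin N ↪ Fin m) : push e (∅ : Finset (Sym2 (Fin N))) = ∅ := map_empty _

/-- The edges of `push e G` at `e v` are the transported edges of `G` at `v`. [cite: Potechin2019, Def. 2.6 (61:5)] -/
theorem filter_mem_push (e : Fin N ↪ Fin m) (G : Finset (Sym2 (Fin N))) (v : Fin N) :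
    (push e G).filter (fun z => e v ∈ z) = push e (G.filter fun z => v ∈ z) := by
  simp only [push, filter_map]
  congr 1
  refine filter_congr fun z _ => ?_
  simp only [Function.comp_apply, Function.Embedding.sym2Map_apply, Sym2.mem_map]
  constructor
  · rintro ⟨w, hw, hwv⟩; rwa [← e.injective hwv]
  · exact fun h => ⟨v, h, rfl⟩

/-- Vertices of a transported edge set lie in the range of the embedding. [cite: Potechin2019, Def. 2.6 (61:5)] -/
theorem filter_mem_push_eq_empty (e : Fin N ↪ Fin m) (G : Finset (Sym2 (Fin N))) {y : Fin m}
    (hy : y ∉ Set.range e) : (push e G).filter (fun z => y ∈ z) = ∅ := by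
  rw [filter_eq_empty_iff]
  intro z hz hyz
  obtain ⟨z', _, rfl⟩ := mem_push.1 hz
  obtain ⟨w, _, hwy⟩ := Sym2.mem_map.1 hyz
  exact hy ⟨w, hwy⟩

/-- Transport preserves partial matchings. [cite: Potechin2019, Def. 6.5 (61:14)] -/
theorem isPartialMatching_push {e : Fin N ↪ Fin m} {G : Finset (Sym2 (Fin N))} :
    IsPartialMatching (push e G) ↔ IsPartialMatching G := by
  constructor
  · intro h
    refine ⟨fun z hz hd => h.1 _ (mem_push.2 ⟨z, hz, rfl⟩) ?_, fun v => ?_⟩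
    · induction z using Sym2.ind with
      | h a b => simp only [Sym2.map_mk, Sym2.mk_isDiag_iff] at hd ⊢; rw [hd]
    · have := h.2 (e v)
      rwa [filter_mem_push, card_push] at this
  · intro h
    refine ⟨fun z hz hd => ?_, fun y => ?_⟩
    · obtain ⟨z', hz', rfl⟩ := mem_push.1 hz
      apply h.1 z' hz'
      induction z' using Sym2.ind with
      | h a b => simp only [Sym2.map_mk, Sym2.mk_isDiag_iff] at hd ⊢; exact e.injective hd
    · by_cases hy : y ∈ Set.range e
      · obtain ⟨v, rfl⟩ := hy
        rw [filter_mem_push, card_push]; exact h.2 v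
      · rw [filter_mem_push_eq_empty e G hy, card_empty]; exact zero_le_one

/-- **Story values of transported monomials** are the parametrised base values.
[cite: Potechin2019, Def. 6.3 and Def. 6.5 (61:14)] -/
theorem storyValue_push (e : Fin N ↪ Fin m) (G : Finset (Sym2 (Fin N))) :
    storyValue m (push e G) = pval m G := by
  by_cases h : IsPartialMatching G
  · rw [storyValue_of (isPartialMatching_push.2 h), pval_of h, card_push]
  · rw [storyValue_of_not (mt isPartialMatching_push.1 h), pval_of_not h]

/-- `E(e(I)) = e(E(I))`. [cite: Potechin2019, Def. 5.1 (61:11)] -/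
theorem innerEdges_map (e : Fin N ↪ Fin m) (I : Finset (Fin N)) :
    innerEdges (I.map e) = push e (innerEdges I) := by
  ext z
  rw [mem_innerEdges, mem_push]
  constructor
  · intro h
    induction z using Sym2.ind with
    | h x y =>
      obtain ⟨x', hx', rfl⟩ := mem_map.1 (h x (Sym2.mem_mk_left x y))
      obtain ⟨y', hy', rfl⟩ := mem_map.1 (h _ (Sym2.mem_mk_right (e x') y))
      exact ⟨s(x', y'), mem_innerEdges.2 fun v hv => by
        rcases Sym2.mem_iff.1 hv with rfl | rfl <;> assumption, rfl⟩
  · rintro ⟨z', hz', rfl⟩ v hv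
    obtain ⟨w, hw, rfl⟩ := Sym2.mem_map.1 hv
    exact mem_map_of_mem e ((mem_innerEdges.1 hz') w hw)

/-- Summing over the subsets of a mapped finset. [folklore] -/
private theorem sum_powerset_map {α β M : Type*} [DecidableEq α] [DecidableEq β] [AddCommMonoid M]
    (f : α ↪ β) (T : Finset α) (g : Finset β → M) :
    ∑ S ∈ (T.map f).powerset, g S = ∑ S ∈ T.powerset, g (S.map f) := by
  refine sum_nbij' (fun S => T.filter fun a => f a ∈ S) (fun S => S.map f) (fun S hS => ?_) (fun S hS => ?_)
    (fun S hS => ?_) (fun S hS => ?_) (fun S hS => ?_)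
  · exact mem_powerset.2 (filter_subset _ _)
  · exact mem_powerset.2 (map_subset_map.2 (mem_powerset.1 hS))
  · have hS' := mem_powerset.1 hS
    ext b
    simp only [mem_map, mem_filter]
    constructor
    · rintro ⟨a, ⟨-, ha⟩, rfl⟩; exact ha
    · intro hb
      obtain ⟨a, ha, rfl⟩ := mem_map.1 (hS' hb)
      exact ⟨a, ⟨ha, hb⟩, rfl⟩
  · have hS' := mem_powerset.1 hS
    ext a
    simp only [mem_filter, mem_map', and_iff_right_iff_imp]
    exact fun ha => hS' ha
  · congr 1
    have hS' := mem_powerset.1 hS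
    ext b
    simp only [mem_map, mem_filter]
    constructor
    · intro hb
      obtain ⟨a, ha, rfl⟩ := mem_map.1 (hS' hb)
      exact ⟨a, ⟨ha, hb⟩, rfl⟩
    · rintro ⟨a, ⟨-, ha⟩, rfl⟩; exact ha

/-- Summing over the subsets of a transported edge set. [cite: Potechin2019, Def. 6.3 (61:14)] -/
theorem sum_powerset_push {M : Type*} [AddCommMonoid M] (e : Fin N ↪ Fin m) (T : Finset (Sym2 (Fin N)))
    (g : Finset (Sym2 (Fin m)) → M) :
    ∑ S ∈ (push e T).powerset, g S = ∑ S ∈ T.powerset, g (push e S) :=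
  sum_powerset_map _ _ _

/-- **Outcome values of transported data** are the parametrised base outcome values.
[cite: Potechin2019, Def. 6.3 and Def. 6.5 (61:14)] -/
theorem outcomeValue_push (e : Fin N ↪ Fin m) (I : Finset (Fin N)) (F C : Finset (Sym2 (Fin N))) :
    outcomeValue m (I.map e) (push e F) (push e C) = poutcome m I F C := by
  rw [outcomeValue, poutcome, innerEdges_map, ← push_sdiff, sum_powerset_push]
  refine sum_congr rfl fun S _ => ?_
  rw [card_push, ← push_union, ← push_union, storyValue_push]

/-- Vertex sets of transported edge sets. [cite: Potechin2019, Def. 2.6 (61:5)] -/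
theorem verts_push (e : Fin N ↪ Fin m) (A : Finset (Sym2 (Fin N))) : verts (push e A) = (verts A).map e := by
  ext y
  simp only [mem_verts, mem_push, mem_map]
  constructor
  · rintro ⟨z, ⟨z', hz', rfl⟩, hy⟩
    obtain ⟨w, hw, rfl⟩ := Sym2.mem_map.1 hy
    exact ⟨w, ⟨z', hz', hw⟩, rfl⟩
  · rintro ⟨w, ⟨z', hz', hw'⟩, rfl⟩
    exact ⟨Sym2.map e z', ⟨z', hz', rfl⟩, Sym2.mem_map.2 ⟨w, hw', rfl⟩⟩

/-- Vertex sets of relabelled edge sets. [cite: Potechin2019, Def. 2.6 (61:5)] -/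
theorem verts_relabel {n : ℕ} (π : Equiv.Perm (Fin n)) (A : Finset (Sym2 (Fin n))) :
    verts (relabel π A) = (verts A).map π.toEmbedding := by
  ext y
  simp only [mem_verts, mem_relabel, mem_map, Equiv.toEmbedding_apply]
  constructor
  · rintro ⟨z, ⟨z', hz', rfl⟩, hy⟩
    obtain ⟨w, hw, rfl⟩ := Sym2.mem_map.1 hy
    exact ⟨w, ⟨z', hz', hw⟩, rfl⟩
  · rintro ⟨w, ⟨z', hz', hw'⟩, rfl⟩
    exact ⟨Sym2.map π z', ⟨z', hz', rfl⟩, Sym2.mem_map.2 ⟨w, hw', rfl⟩⟩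

/-! ### §C3 Symmetries of the outcome values and of the stabiliser sums -/

/-- Outcome values are invariant under the stabiliser of `I`: `Ẽ[x_{κC} 1_F] = Ẽ[x_C 1_F]` for
`κ ∈ stab I`, `F ⊆ E(I)`. [cite: Potechin2019, Thm. 5.12 (1) and Def. 5.9 (1) (61:11–61:12)] -/
theorem outcomeValue_relabel {I₀ : Finset (Fin m)} {F₀ : Finset (Sym2 (Fin m))} (hF : F₀ ⊆ innerEdges I₀)
    {κ : Equiv.Perm (Fin m)} (hκ : κ ∈ stab I₀) (C : Finset (Sym2 (Fin m))) :
    outcomeValue m I₀ F₀ (relabel κ C) = outcomeValue m I₀ F₀ C := by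
  unfold outcomeValue
  refine sum_congr rfl fun S hS => ?_
  have hS' : S ⊆ innerEdges I₀ := (mem_powerset.1 hS).trans sdiff_subset
  rw [← storyValue_relabel κ (C ∪ F₀ ∪ S), relabel_union, relabel_union,
    relabel_eq_self_of_subset_innerEdges hF hκ, relabel_eq_self_of_subset_innerEdges hS' hκ]

/-- Transport intertwines base transpositions with world transpositions. [cite: Potechin2019, Def. 6.5 (61:14)] -/
theorem relabel_swap_push (e : Fin N ↪ Fin m) (a b : Fin N) (B : Finset (Sym2 (Fin N))) :
    relabel (Equiv.swap (e a) (e b)) (push e B) = push e (relabel (Equiv.swap a b) B) := by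
  ext z
  simp only [mem_relabel, mem_push]
  have key : ∀ z' : Sym2 (Fin N), Sym2.map (Equiv.swap (e a) (e b)) (Sym2.map e z') =
      Sym2.map e (Sym2.map (Equiv.swap a b) z') := fun z' => by
    rw [Sym2.map_map, Sym2.map_map]
    congr 1
    funext x
    simp only [Function.comp_apply]
    exact (e.injective.map_swap a b x).symm
  constructor
  · rintro ⟨w, ⟨z', hz', rfl⟩, rfl⟩
    exact ⟨Sym2.map (Equiv.swap a b) z', ⟨z', hz', rfl⟩, (key z').symm⟩
  · rintro ⟨w, ⟨z', hz', rfl⟩, rfl⟩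
    exact ⟨Sym2.map e z', ⟨z', hz', rfl⟩, key z'⟩

/-- **Coset decomposition of a pointwise stabiliser along one exposed vertex**: for `b ∉ J`,
`Σ_{σ ∈ stab J} g(σ) = Σ_{y ∉ J} Σ_{τ ∈ stab (J ∪ {y})} g(τ · (b y))` — classify `σ` by `y = σ(b)`.
[cite: Potechin2019, §3.1 and Def. 5.2 (61:7, 61:11: querying one more index)] -/
theorem sum_stab_eq_sum_sum {n : ℕ} {M : Type*} [AddCommMonoid M] (J : Finset (Fin n)) {b : Fin n}
    (hb : b ∉ J) (g : Equiv.Perm (Fin n) → M) :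
    ∑ σ ∈ stab J, g σ = ∑ y ∈ univ \ J, ∑ τ ∈ stab (insert y J), g (τ * Equiv.swap b y) := by
  classical
  rw [sum_sigma']
  symm
  refine sum_nbij' (fun p => p.2 * Equiv.swap b p.1) (fun σ => ⟨σ b, σ * Equiv.swap b (σ b)⟩)
    (fun p hp => ?_) (fun σ hσ => ?_) (fun p hp => ?_) (fun σ hσ => ?_) (fun p hp => rfl)
  · obtain ⟨y, τ⟩ := p
    simp only [mem_sigma, mem_sdiff, mem_univ, true_and] at hp
    refine mem_stab.2 fun j hj => ?_
    have hjb : j ≠ b := by rintro rfl; exact hb hj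
    have hjy : j ≠ y := by rintro rfl; exact hp.1 hj
    rw [Equiv.Perm.mul_apply, Equiv.swap_apply_of_ne_of_ne hjb hjy]
    exact mem_stab.1 hp.2 j (mem_insert_of_mem hj)
  · have hσb : σ b ∉ J := fun h => hb (by
      have := mem_stab.1 hσ (σ b) h
      rwa [σ.injective this] at h)
    simp only [mem_sigma, mem_sdiff, mem_univ, true_and]
    refine ⟨hσb, mem_stab.2 fun j hj => ?_⟩
    rcases mem_insert.1 hj with hjy | hjJ
    · rw [hjy, Equiv.Perm.mul_apply, Equiv.swap_apply_right]
    · have hjb : j ≠ b := by rintro rfl; exact hb hjJ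
      have hjσ : j ≠ σ b := by rintro rfl; exact hσb hjJ
      rw [Equiv.Perm.mul_apply, Equiv.swap_apply_of_ne_of_ne hjb hjσ]
      exact mem_stab.1 hσ j hjJ
  · obtain ⟨y, τ⟩ := p
    simp only [mem_sigma, mem_sdiff, mem_univ, true_and] at hp
    have h1 : (τ * Equiv.swap b y) b = y := by
      rw [Equiv.Perm.mul_apply, Equiv.swap_apply_left]; exact mem_stab.1 hp.2 y (mem_insert_self _ _)
    simp only [h1, mul_assoc, Equiv.swap_mul_self, mul_one]
  · simp only [mul_assoc, Equiv.swap_mul_self, mul_one]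

/-- Conjugating the stabiliser of `J ∪ {y}` to that of `J ∪ {y'}` by the transposition `(y y')`
(`y, y' ∉ J`). [cite: Potechin2019, Thm. 4.1 (61:10, symmetry under permutations of [1,n] ∖ I)] -/
theorem sum_stab_insert_conj {n : ℕ} {M : Type*} [AddCommMonoid M] (J : Finset (Fin n)) {y y' : Fin n}
    (hy : y ∉ J) (hy' : y' ∉ J) (h : Equiv.Perm (Fin n) → M) :
    ∑ τ ∈ stab (insert y' J), h τ =
      ∑ τ ∈ stab (insert y J), h (Equiv.swap y y' * τ * Equiv.swap y y') := by
  classical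
  set κ := Equiv.swap y y' with hκ
  have hκJ : ∀ j ∈ J, κ j = j := fun j hj =>
    Equiv.swap_apply_of_ne_of_ne (fun h => hy (h ▸ hj)) (fun h => hy' (h ▸ hj))
  have conj_mem : ∀ (u u' : Fin n), κ u = u' → κ u' = u → ∀ τ ∈ stab (insert u J),
      κ * τ * κ ∈ stab (insert u' J) := by
    intro u u' h1 h2 τ hτ
    refine mem_stab.2 fun j hj => ?_
    rcases mem_insert.1 hj with rfl | hj
    · rw [Equiv.Perm.mul_apply, Equiv.Perm.mul_apply, h2, mem_stab.1 hτ u (mem_insert_self _ _), h1]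
    · rw [Equiv.Perm.mul_apply, Equiv.Perm.mul_apply, hκJ j hj, mem_stab.1 hτ j (mem_insert_of_mem hj), hκJ j hj]
  have h1 : κ y = y' := by rw [hκ, Equiv.swap_apply_left]
  have h2 : κ y' = y := by rw [hκ, Equiv.swap_apply_right]
  symm
  refine sum_nbij' (fun τ => κ * τ * κ) (fun τ => κ * τ * κ) (fun τ hτ => conj_mem y y' h1 h2 τ hτ)
    (fun τ hτ => conj_mem y' y h2 h1 τ hτ) (fun τ _ => ?_) (fun τ _ => ?_) (fun τ _ => rfl)
  · calc κ * (κ * τ * κ) * κ = (κ * κ) * τ * (κ * κ) := by group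
      _ = τ := by rw [hκ, Equiv.swap_mul_self, one_mul, mul_one]
  · calc κ * (κ * τ * κ) * κ = (κ * κ) * τ * (κ * κ) := by group
      _ = τ := by rw [hκ, Equiv.swap_mul_self, one_mul, mul_one]

/-- A product of two transpositions, rewritten (`b ∉ {y, y'}`):
`(y y')(b y') = (b y)(y y')`. [cite: Potechin2019, Thm. 4.1 (61:10)] -/
theorem swap_mul_swap_of_ne {n : ℕ} {b y y' : Fin n} (hby : b ≠ y) (hby' : b ≠ y') :
    Equiv.swap y y' * Equiv.swap b y' = Equiv.swap b y * Equiv.swap y y' := by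
  rw [Equiv.mul_swap_eq_swap_mul, Equiv.swap_apply_of_ne_of_ne hby hby', Equiv.swap_apply_right]

/-! ### §C4 Clearing denominators: the story values as polynomials in the size parameter -/

/-- `D_J(X) = ∏_{j<J} (X − 1 − 2j)`, the common denominator of the story moments `μ_m(ℓ)`, `ℓ ≤ J`.
[cite: Potechin2019, Def. 6.3 and §6.4 (61:14, 61:16: "the common denominator")] -/
def Dpoly (J : ℕ) : Polynomial ℝ := ∏ j ∈ range J, (Polynomial.X - Polynomial.C (1 + 2 * (j : ℝ)))

/-- Evaluation of `D_J`. [cite: Potechin2019, Def. 6.3 (61:14)] -/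
theorem eval_Dpoly (J : ℕ) (x : ℝ) : (Dpoly J).eval x = ∏ j ∈ range J, (x - 1 - 2 * j) := by
  simp only [Dpoly, Polynomial.eval_prod, Polynomial.eval_sub, Polynomial.eval_X, Polynomial.eval_C]
  exact prod_congr rfl fun j _ => by ring

/-- `D_J(x) ≠ 0` off its roots. [cite: Potechin2019, Lemma 6.7 (61:14, "q_S ≠ 0")] -/
theorem eval_Dpoly_ne_zero {J : ℕ} {x : ℝ} (hx : ∀ j < J, x - 1 - 2 * j ≠ 0) : (Dpoly J).eval x ≠ 0 := by
  rw [eval_Dpoly]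
  exact prod_ne_zero_iff.2 fun j hj => hx j (mem_range.1 hj)

open Classical in
/-- `D_J · Ẽ[x_G]` as a polynomial in the size parameter: `[G matching] ∏_{|G| ≤ j < J}(X − 1 − 2j)`.
[cite: Potechin2019, Def. 6.3 (61:14, "rational functions of the parameters … with a common denominator")] -/
def pvalPoly (J : ℕ) (G : Finset (Sym2 (Fin N))) : Polynomial ℝ :=
  if IsPartialMatching G then ∏ j ∈ Ico G.card J, (Polynomial.X - Polynomial.C (1 + 2 * (j : ℝ))) else 0

/-- Evaluation: `D_J(m) · pval m G = pvalPoly J G (m)` when no factor of `D_J(m)` vanishes and `|G| ≤ J`.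
[cite: Potechin2019, Def. 6.3 and Lemma 6.7 (61:14)] -/
theorem eval_pvalPoly {J : ℕ} {x : ℝ} {m : ℕ} (hxm : x = (m : ℝ)) (hx : ∀ j < J, x - 1 - 2 * j ≠ 0)
    {G : Finset (Sym2 (Fin N))} (hG : IsPartialMatching G → G.card ≤ J) :
    (pvalPoly J G).eval x = (Dpoly J).eval x * pval m G := by
  classical
  by_cases h : IsPartialMatching G
  · have hle := hG h
    rw [pvalPoly, if_pos h, pval_of h, Polynomial.eval_prod, eval_Dpoly, moment_eq_inv_prod]
    simp only [Polynomial.eval_sub, Polynomial.eval_X, Polynomial.eval_C]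
    rw [← prod_range_mul_prod_Ico _ hle, hxm]
    have hne : ∏ j ∈ range G.card, ((m : ℝ) - 1 - 2 * j) ≠ 0 :=
      prod_ne_zero_iff.2 fun j hj => by rw [← hxm]; exact hx j (lt_of_lt_of_le (mem_range.1 hj) hle)
    rw [mul_assoc, mul_comm (∏ j ∈ Ico _ _, _), ← mul_assoc, mul_inv_cancel₀ hne, one_mul]
    exact prod_congr rfl fun j _ => by ring
  · rw [pvalPoly, if_neg h, pval_of_not h, Polynomial.eval_zero, mul_zero]

/-- `D_J · Ẽ[x_C 1_F]` as a polynomial in the size parameter. [cite: Potechin2019, Def. 6.3 (61:14)] -/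
def poutcomePoly (J : ℕ) (I : Finset (Fin N)) (F C₀ : Finset (Sym2 (Fin N))) : Polynomial ℝ :=
  ∑ S ∈ (innerEdges I \ F).powerset, Polynomial.C ((-1 : ℝ) ^ S.card) * pvalPoly J (C₀ ∪ F ∪ S)

/-- Evaluation of `poutcomePoly`. [cite: Potechin2019, Def. 6.3 and Lemma 6.7 (61:14)] -/
theorem eval_poutcomePoly {J : ℕ} {x : ℝ} {m : ℕ} (hxm : x = (m : ℝ)) (hx : ∀ j < J, x - 1 - 2 * j ≠ 0)
    {I : Finset (Fin N)} {F C₀ : Finset (Sym2 (Fin N))}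
    (hJ : ∀ S ⊆ innerEdges I \ F, IsPartialMatching (C₀ ∪ F ∪ S) → (C₀ ∪ F ∪ S).card ≤ J) :
    (poutcomePoly J I F C₀).eval x = (Dpoly J).eval x * poutcome m I F C₀ := by
  simp only [poutcomePoly, poutcome, Polynomial.eval_finsetSum, Polynomial.eval_mul, Polynomial.eval_C, mul_sum]
  refine sum_congr rfl fun S hS => ?_
  rw [eval_pvalPoly hxm hx (hJ S (mem_powerset.1 hS))]
  ring

/-! ### §C5 The stabiliser sums over a world and their polynomiality -/

/-- **The stabiliser sum** of a world `(m, e)`: `Σ_{σ ∈ stab e(I')} Ẽ_m[x_{e(A) ∪ σ e(B')} 1_{e(F)}]`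
(the un-normalised average over `S_{[m] ∖ e(I')}` of the symmetrised monomial `x_{B'}` against `x_A`).
[cite: Potechin2019, Thm. 5.12 (2) and Prop. 5.7 (61:11–61:12)] -/
def wsum (m : ℕ) (e : Fin N ↪ Fin m) (I : Finset (Fin N)) (F A : Finset (Sym2 (Fin N)))
    (I' : Finset (Fin N)) (B' : Finset (Sym2 (Fin N))) : ℝ :=
  ∑ σ ∈ stab (I'.map e), outcomeValue m (I.map e) (push e F) (push e A ∪ relabel σ (push e B'))

/-- **Leaves**: if all vertices of `B'` are pinned (`verts B' ⊆ I'`) the stabiliser sum is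
`(m − |I'|)! · Ẽ_m[x_{A ∪ B'} 1_F]`. [cite: Potechin2019, Prop. 5.7 (61:11)] -/
theorem wsum_leaf (e : Fin N ↪ Fin m) (I : Finset (Fin N)) (F A : Finset (Sym2 (Fin N)))
    {I' : Finset (Fin N)} {B' : Finset (Sym2 (Fin N))} (hB' : verts B' ⊆ I') :
    wsum m e I F A I' B' = ((m - I'.card).factorial : ℝ) * poutcome m I F (A ∪ B') := by
  unfold wsum
  have : ∀ σ ∈ stab (I'.map e), outcomeValue m (I.map e) (push e F) (push e A ∪ relabel σ (push e B'))
      = poutcome m I F (A ∪ B') := by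
    intro σ hσ
    have hσ' : σ ∈ stab (verts (push e B')) := by
      rw [verts_push]; exact stab_mono (map_subset_map.2 hB') hσ
    rw [relabel_eq_self_of_mem_stab hσ', ← push_union, outcomeValue_push]
  rw [sum_congr rfl this, sum_const, card_stab, card_map, nsmul_eq_mul]

/-- **Generic branches agree**: conjugation by `(y y')` identifies the branch `σ(b) = y'` with the
branch `σ(b) = y` of the stabiliser sum whenever `y, y' ∉ J ∪ verts A₀` and the transpositions match on
`B₀`. [cite: Potechin2019, Thm. 4.1 and Prop. 5.7 (61:10–61:11)] -/
theorem branch_eq_of_swap {I₀ J : Finset (Fin m)} {F₀ A₀ B₀ : Finset (Sym2 (Fin m))} (hF : F₀ ⊆ innerEdges I₀)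
    (hIJ : I₀ ⊆ J) {b y y' : Fin m} (hy : y ∉ J) (hy' : y' ∉ J) (hyA : y ∉ verts A₀) (hy'A : y' ∉ verts A₀)
    (hB : relabel (Equiv.swap y y' * Equiv.swap b y') B₀ = relabel (Equiv.swap b y) B₀) :
    ∑ τ ∈ stab (insert y' J), outcomeValue m I₀ F₀ (A₀ ∪ relabel (τ * Equiv.swap b y') B₀) =
      ∑ τ ∈ stab (insert y J), outcomeValue m I₀ F₀ (A₀ ∪ relabel (τ * Equiv.swap b y) B₀) := by
  rw [sum_stab_insert_conj J hy hy']
  refine sum_congr rfl fun τ _ => ?_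
  set κ := Equiv.swap y y' with hκ
  have hκI : κ ∈ stab I₀ := mem_stab.2 fun i hi =>
    Equiv.swap_apply_of_ne_of_ne (by rintro rfl; exact hy (hIJ hi)) (by rintro rfl; exact hy' (hIJ hi))
  have hκA : relabel κ A₀ = A₀ := relabel_eq_self_of_mem_stab (mem_stab.2 fun v hv =>
    Equiv.swap_apply_of_ne_of_ne (by rintro rfl; exact hyA hv) (by rintro rfl; exact hy'A hv))
  have : relabel (κ * τ * κ * Equiv.swap b y') B₀ = relabel κ (relabel τ (relabel (Equiv.swap b y) B₀)) := by
    rw [← hB, ← relabel_mul, ← relabel_mul]; congr 1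
  rw [this]
  conv_lhs => rw [← hκA, ← relabel_union]
  rw [outcomeValue_relabel hF hκI, relabel_mul]

/-- Branches indexed by base vertices are stabiliser sums of smaller states:
`Σ_{τ ∈ stab e(I' ∪ {c})} Ẽ[x_{eA ∪ τ (e b₀, e c) e B'} 1_F] = wsum (I' ∪ {c}) ((b₀ c)·B')`.
[cite: Potechin2019, Def. 5.2 (61:11, substories after querying one more index)] -/
theorem branch_base (e : Fin N ↪ Fin m) (I : Finset (Fin N)) (F A : Finset (Sym2 (Fin N)))
    (I' : Finset (Fin N)) (B' : Finset (Sym2 (Fin N))) (b₀ c : Fin N) :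
    ∑ τ ∈ stab (insert (e c) (I'.map e)),
        outcomeValue m (I.map e) (push e F) (push e A ∪ relabel (τ * Equiv.swap (e b₀) (e c)) (push e B'))
      = wsum m e I F A (insert c I') (relabel (Equiv.swap b₀ c) B') := by
  unfold wsum
  rw [map_insert]
  refine sum_congr rfl fun τ _ => ?_
  rw [relabel_mul, relabel_swap_push]

/-- **The exposure recursion for stabiliser sums.** Expose a free vertex `b₀` of `B'`: the
stabiliser sum splits according to `σ(e b₀)`; the branches `σ(e b₀) = e c`, `c ∈ (verts A ∪ verts B') ∖ I'`,
are stabiliser sums of the smaller states `(I' ∪ {c}, (b₀ c)·B')`, and all the remaining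
`m − |I'| − |(verts A ∪ verts B') ∖ I'|` branches are equal to the branch of a base vertex `c₀`
(`c₀ = b₀` if `b₀ ∉ verts A`, else any fresh base vertex).
[cite: Potechin2019, Thm. 5.12 (2) and Def. 5.10 (61:11–61:12)] -/
theorem wsum_recursion (e : Fin N ↪ Fin m) {I I' : Finset (Fin N)} {F A B' : Finset (Sym2 (Fin N))}
    (hF : F ⊆ innerEdges I) (hII' : I ⊆ I') {b₀ : Fin N} (hb₀ : b₀ ∈ verts B') (hb₀I : b₀ ∉ I')
    {c₀ : Fin N} (hc₀I : c₀ ∉ I') (hc₀ : (c₀ = b₀ ∧ b₀ ∉ verts A) ∨ (c₀ ∉ verts A ∧ c₀ ∉ verts B')) :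
    wsum m e I F A I' B' =
      ∑ c ∈ (verts A ∪ verts B') \ I', wsum m e I F A (insert c I') (relabel (Equiv.swap b₀ c) B')
      + ((m - I'.card - ((verts A ∪ verts B') \ I').card : ℕ) : ℝ) *
          wsum m e I F A (insert c₀ I') (relabel (Equiv.swap b₀ c₀) B') := by
  classical
  set J := I'.map e with hJ
  set b := e b₀ with hb
  set Cset := (verts A ∪ verts B') \ I' with hC
  set f : Fin m → ℝ := fun y => ∑ τ ∈ stab (insert y J),
    outcomeValue m (I.map e) (push e F) (push e A ∪ relabel (τ * Equiv.swap b y) (push e B')) with hf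
  have hbJ : b ∉ J := by rw [hJ, hb, mem_map' ]; exact hb₀I
  have hIJ : I.map e ⊆ J := map_subset_map.2 hII'
  have hFJ : push e F ⊆ innerEdges (I.map e) := by rw [innerEdges_map]; exact map_subset_map.2 hF
  -- step 1: classify by `σ(b)`
  have h1 : wsum m e I F A I' B' = ∑ y ∈ univ \ J, f y := by
    unfold wsum; rw [← hJ]; exact sum_stab_eq_sum_sum J hbJ _
  -- the base branches
  have hbase : ∀ c : Fin N, f (e c) = wsum m e I F A (insert c I') (relabel (Equiv.swap b₀ c) B') :=
    fun c => branch_base e I F A I' B' b₀ c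
  -- step 2: split the range of `y`
  have hCsub : Cset.map e ⊆ univ \ J := by
    intro y hy
    obtain ⟨c, hc, rfl⟩ := mem_map.1 hy
    rw [mem_sdiff, hJ, mem_map']
    exact ⟨mem_univ _, (mem_sdiff.1 hc).2⟩
  have h2 : ∑ y ∈ univ \ J, f y = ∑ y ∈ Cset.map e, f y + ∑ y ∈ (univ \ J) \ Cset.map e, f y := by
    rw [← sum_sdiff hCsub, add_comm]
  have h3 : ∑ y ∈ Cset.map e, f y = ∑ c ∈ Cset, wsum m e I F A (insert c I') (relabel (Equiv.swap b₀ c) B') := by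
    rw [sum_map]; exact sum_congr rfl fun c _ => hbase c
  -- step 3: the generic branches all equal `f (e c₀)`
  have hrest : ∀ y ∈ (univ \ J) \ Cset.map e, y ∉ (verts A).map e ∧ y ∉ (verts B').map e ∧ y ∉ J := by
    intro y hy
    rw [mem_sdiff, mem_sdiff] at hy
    have key : ∀ S : Finset (Fin N), S ⊆ verts A ∪ verts B' → y ∉ S.map e := by
      intro S hS hyS
      obtain ⟨a, ha, rfl⟩ := mem_map.1 hyS
      by_cases haI : a ∈ I'
      · exact hy.1.2 (by rw [hJ]; exact mem_map_of_mem e haI)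
      · exact hy.2 (mem_map_of_mem e (by rw [hC, mem_sdiff]; exact ⟨hS ha, haI⟩))
    exact ⟨key _ subset_union_left, key _ subset_union_right, hy.1.2⟩
  have hc₀A' : c₀ ∉ verts A := by rcases hc₀ with ⟨rfl, h⟩ | ⟨h, -⟩ <;> exact h
  have hc₀A : e c₀ ∉ verts (push e A) := by rw [verts_push, mem_map']; exact hc₀A'
  have hc₀J : e c₀ ∉ J := by rw [hJ, mem_map']; exact hc₀I
  have hgen : ∀ y ∈ (univ \ J) \ Cset.map e, f y = f (e c₀) := by
    intro y hy
    obtain ⟨hyA, hyB, hyJ⟩ := hrest y hy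
    by_cases hyc : y = e c₀
    · rw [hyc]
    rw [hf]
    refine branch_eq_of_swap (I₀ := I.map e) (J := J) (A₀ := push e A) (B₀ := push e B') hFJ hIJ hc₀J hyJ hc₀A
      (by rwa [verts_push]) ?_
    -- the transposition identity on `e B'`
    rcases hc₀ with ⟨rfl, -⟩ | ⟨-, hc₀B⟩
    · -- `c₀ = b₀`: both sides are the identity relabelling
      rw [← hb, Equiv.swap_mul_self, Equiv.swap_self]; rfl
    · have hbc : b ≠ e c₀ := by
        rw [hb]; intro h; exact hc₀B (e.injective h ▸ hb₀)
      have hby : b ≠ y := by rintro rfl; exact hyB (by rw [hb]; exact mem_map_of_mem e hb₀)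
      rw [swap_mul_swap_of_ne hbc hby, relabel_mul]
      congr 1
      refine relabel_eq_self_of_mem_stab (mem_stab.2 fun v hv => Equiv.swap_apply_of_ne_of_ne ?_ ?_)
      · rintro rfl; rw [verts_push, mem_map'] at hv; exact hc₀B hv
      · rintro rfl; rw [verts_push] at hv; exact hyB hv
  have h4 : ∑ y ∈ (univ \ J) \ Cset.map e, f y =
      ((m - I'.card - Cset.card : ℕ) : ℝ) * wsum m e I F A (insert c₀ I') (relabel (Equiv.swap b₀ c₀) B') := by
    rw [sum_congr rfl hgen, sum_const, nsmul_eq_mul, hbase c₀, card_sdiff_of_subset hCsub,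
      card_sdiff_of_subset (subset_univ _), card_univ, Fintype.card_fin, card_map, card_map]
  rw [h1, h2, h3, h4]

/-- Vertex sets of unions. [cite: Potechin2019, Def. 2.6 (61:5)] -/
theorem verts_union {n : ℕ} (X Y : Finset (Sym2 (Fin n))) : verts (X ∪ Y) = verts X ∪ verts Y := by
  ext v; simp only [mem_verts, mem_union]; constructor
  · rintro ⟨e, he | he, hv⟩
    · exact Or.inl ⟨e, he, hv⟩
    · exact Or.inr ⟨e, he, hv⟩
  · rintro (⟨e, he, hv⟩ | ⟨e, he, hv⟩)
    · exact ⟨e, Or.inl he, hv⟩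
    · exact ⟨e, Or.inr he, hv⟩

/-- In any world containing `e(I')` and `e(C)` for `C` disjoint from `I'`: `|I'| + |C| ≤ m`.
[cite: Potechin2019, Def. 6.5 (61:14)] -/
theorem card_add_card_le_of_world (e : Fin N ↪ Fin m) {I' C₀ : Finset (Fin N)} (h : Disjoint I' C₀) :
    I'.card + C₀.card ≤ m := by
  have := card_le_univ ((I' ∪ C₀).map e)
  rwa [card_map, card_union_of_disjoint h, Fintype.card_fin] at this

/-- **The free vertices after one exposure step**: pinning `b₀ ↦ c` leaves `t` free vertices.
[cite: Potechin2019, Def. 5.10 (61:11, "level (r−1, n'−1) good stories for (P, A ∪ (i))")] -/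
theorem card_verts_swap_sdiff {I' : Finset (Fin N)} {B' : Finset (Sym2 (Fin N))} {b₀ c : Fin N} {t : ℕ}
    (hb₀ : b₀ ∈ verts B') (hb₀I : b₀ ∉ I') (hcI : c ∉ I') (ht : ((verts B') \ I').card = t + 1) :
    ((verts (relabel (Equiv.swap b₀ c) B')) \ insert c I').card = t := by
  classical
  set π := Equiv.swap b₀ c with hπ
  have hπI : ∀ i ∈ I', π i = i := fun i hi =>
    Equiv.swap_apply_of_ne_of_ne (by rintro rfl; exact hb₀I hi) (by rintro rfl; exact hcI hi)
  have hππ : ∀ x, π (π x) = x := fun x => by rw [hπ, Equiv.swap_apply_self]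
  have htarget : (((verts B') \ I').erase b₀).card = t := by
    rw [card_erase_of_mem (mem_sdiff.2 ⟨hb₀, hb₀I⟩), ht]; rfl
  rw [← htarget]
  refine card_nbij' (fun x => π x) (fun y => π y) (fun x hx => ?_) (fun y hy => ?_) (fun x _ => hππ x) (fun y _ => hππ y)
  · simp only [mem_coe, mem_sdiff, mem_insert, not_or, verts_relabel, Finset.mem_map_equiv] at hx
    simp only [mem_coe, mem_erase, mem_sdiff]
    refine ⟨fun h => hx.2.1 (by rw [← hππ x, h, hπ, Equiv.swap_apply_left]), ?_, fun h => hx.2.2 ?_⟩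
    · rw [hπ, Equiv.symm_swap] at hx; exact hx.1
    · rwa [← hππ x, hπI _ h]
  · simp only [mem_coe, mem_erase, mem_sdiff] at hy
    simp only [mem_coe, mem_sdiff, mem_insert, not_or, verts_relabel, Finset.mem_map_equiv]
    refine ⟨by rw [hπ, Equiv.symm_swap, Equiv.swap_apply_self]; exact hy.2.1, fun h => hy.1 ?_, fun h => hy.2.2 ?_⟩
    · rw [← hππ y, h, hπ, Equiv.swap_apply_right]
    · rwa [← hππ y, hπI _ h]

/-- **A fresh base vertex exists** when the exposed free vertex of `B'` is a vertex of `A`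
(the fitting invariant leaves room). [cite: Potechin2019, Thm. 5.11 proof (61:12–61:13, the index-degree bookkeeping)] -/
theorem exists_fresh {I' : Finset (Fin N)} {A B' : Finset (Sym2 (Fin N))} {b₀ : Fin N} {t : ℕ}
    (hb₀ : b₀ ∈ verts B') (hb₀I : b₀ ∉ I') (hb₀A : b₀ ∈ verts A) (ht : ((verts B') \ I').card = t + 1)
    (hfit : I'.card + ((verts A) \ I').card + (t + 1) ≤ N) :
    ∃ c₀ : Fin N, c₀ ∉ I' ∧ c₀ ∉ verts A ∧ c₀ ∉ verts B' := by
  classical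
  set U := I' ∪ verts A ∪ verts B' with hU
  have h1 : U = I' ∪ (verts A \ I') ∪ (verts B' \ (I' ∪ verts A)) := by
    ext x; simp only [hU, mem_union, mem_sdiff]; tauto
  have h2 : (verts B' \ (I' ∪ verts A)) ⊆ ((verts B') \ I').erase b₀ := by
    intro x hx
    rw [mem_sdiff, mem_union, not_or] at hx
    exact mem_erase.2 ⟨by rintro rfl; exact hx.2.2 hb₀A, mem_sdiff.2 ⟨hx.1, hx.2.1⟩⟩
  have h3 : U.card ≤ N - 1 := by
    have := card_le_card h2
    rw [card_erase_of_mem (mem_sdiff.2 ⟨hb₀, hb₀I⟩), ht] at this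
    rw [h1]
    refine (card_union_le _ _).trans ?_
    have := card_union_le I' (verts A \ I')
    omega
  have h4 : (univ \ U).Nonempty := by
    rw [← card_pos, card_sdiff_of_subset (subset_univ _), card_univ, Fintype.card_fin]
    have : 0 < N := lt_of_lt_of_le (Nat.succ_pos _) (le_trans (Nat.le_add_left _ _) hfit)
    omega
  obtain ⟨c₀, hc₀⟩ := h4
  simp only [mem_sdiff, mem_univ, true_and, hU, mem_union, not_or] at hc₀
  exact ⟨c₀, hc₀.1.1, hc₀.1.2, hc₀.2⟩

/-- **Polynomiality of the stabiliser sums** (the engine of the interpolation): for every state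
`(I', B')` reachable from `(I, B)` under the fitting invariant `|I'| + |verts A ∖ I'| + |verts B' ∖ I'| ≤ N`
there is ONE real polynomial `Q` with `D_J(m) · wsum_{m,e}(I', B') = (m − |I'| − t)! · Q(m)` in every world
`(m, e)` off the roots of `D_J` (`N ≤ 2J + 1`).  Proof: induction on the number `t` of free vertices
via `wsum_recursion`. [cite: Potechin2019, Lemma 6.6–6.7 (61:14–61:15: the quantities are rational functions
of the parameters with a common denominator)] -/
theorem wsum_poly {I : Finset (Fin N)} {F A : Finset (Sym2 (Fin N))} (hF : F ⊆ innerEdges I) {J : ℕ}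
    (hJ : N ≤ 2 * J + 1) :
    ∀ (t : ℕ) (I' : Finset (Fin N)) (B' : Finset (Sym2 (Fin N))), I ⊆ I' → ((verts B') \ I').card = t →
      I'.card + ((verts A) \ I').card + t ≤ N →
      ∃ Q : Polynomial ℝ, ∀ (m : ℕ) (e : Fin N ↪ Fin m), (∀ j < J, (m : ℝ) - 1 - 2 * j ≠ 0) →
        (Dpoly J).eval (m : ℝ) * wsum m e I F A I' B' = ((m - I'.card - t).factorial : ℝ) * Q.eval (m : ℝ) := by
  classical
  intro t
  induction t with
  | zero =>
    intro I' B' hII' ht hfit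
    have hB' : verts B' ⊆ I' := by
      intro v hv; by_contra h
      have : v ∈ verts B' \ I' := mem_sdiff.2 ⟨hv, h⟩
      rw [card_eq_zero.1 ht] at this; exact notMem_empty v this
    refine ⟨poutcomePoly J I F (A ∪ B'), fun m e hm => ?_⟩
    rw [wsum_leaf e I F A hB', Nat.sub_zero, mul_left_comm,
      ← eval_poutcomePoly (m := m) rfl hm (fun S hS hpm => ?_)]
    -- every partial matching occurring has at most `J` edges
    have hv : verts (A ∪ B' ∪ F ∪ S) ⊆ I' ∪ (verts A \ I') := by
      rw [union_sdiff_self_eq_union, verts_union, verts_union, verts_union]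
      refine union_subset (union_subset (union_subset subset_union_right (hB'.trans subset_union_left)) ?_) ?_
      · exact ((verts_subset_of_subset_innerEdges hF).trans hII').trans subset_union_left
      · exact ((verts_subset_of_subset_innerEdges (hS.trans sdiff_subset)).trans hII').trans subset_union_left
    have h1 := card_le_card hv
    rw [hpm.card_verts] at h1
    have h2 := card_union_le I' (verts A \ I')
    omega
  | succ t ih =>
    intro I' B' hII' ht hfit
    obtain ⟨b₀, hb₀⟩ : ((verts B') \ I').Nonempty := by rw [← card_pos, ht]; exact Nat.succ_pos _
    rw [mem_sdiff] at hb₀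
    -- the recursive states
    have IH' : ∀ c : Fin N, c ∉ I' → ∃ Q : Polynomial ℝ, ∀ (m : ℕ) (e : Fin N ↪ Fin m),
        (∀ j < J, (m : ℝ) - 1 - 2 * j ≠ 0) →
        (Dpoly J).eval (m : ℝ) * wsum m e I F A (insert c I') (relabel (Equiv.swap b₀ c) B') =
          ((m - I'.card - (t + 1)).factorial : ℝ) * Q.eval (m : ℝ) := by
      intro c hc
      obtain ⟨Q, hQ⟩ := ih (insert c I') (relabel (Equiv.swap b₀ c) B') (hII'.trans (subset_insert _ _))
        (card_verts_swap_sdiff hb₀.1 hb₀.2 hc ht) (by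
          rw [card_insert_of_notMem hc]
          have : (verts A \ insert c I').card ≤ (verts A \ I').card :=
            card_le_card (sdiff_subset_sdiff subset_rfl (subset_insert _ _))
          omega)
      refine ⟨Q, fun m e hm => ?_⟩
      rw [hQ m e hm, card_insert_of_notMem hc]
      have : m - (I'.card + 1) - t = m - I'.card - (t + 1) := by omega
      rw [this]
    choose Q hQ using IH'
    -- the distinguished vertex `c₀`
    have hc₀ex : ∃ c₀ : Fin N, c₀ ∉ I' ∧ ((c₀ = b₀ ∧ b₀ ∉ verts A) ∨ (c₀ ∉ verts A ∧ c₀ ∉ verts B')) := by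
      by_cases hbA : b₀ ∈ verts A
      · obtain ⟨c₀, h1, h2, h3⟩ := exists_fresh hb₀.1 hb₀.2 hbA ht hfit
        exact ⟨c₀, h1, Or.inr ⟨h2, h3⟩⟩
      · exact ⟨b₀, hb₀.2, Or.inl ⟨rfl, hbA⟩⟩
    obtain ⟨c₀, hc₀I, hc₀⟩ := hc₀ex
    set Cset := (verts A ∪ verts B') \ I' with hC
    refine ⟨(∑ c ∈ Cset.attach, Q c.1 (mem_sdiff.1 c.2).2) +
      (Polynomial.X - Polynomial.C ((I'.card : ℝ) + Cset.card)) * Q c₀ hc₀I, fun m e hm => ?_⟩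
    rw [wsum_recursion e hF hII' hb₀.1 hb₀.2 hc₀I hc₀]
    simp only [← hC]
    rw [mul_add, mul_sum, Polynomial.eval_add, Polynomial.eval_finsetSum, mul_add, mul_sum, ← sum_attach Cset]
    have hCm : I'.card + Cset.card ≤ m := card_add_card_le_of_world e disjoint_sdiff
    congr 1
    · exact sum_congr rfl fun c _ => hQ c.1 (mem_sdiff.1 c.2).2 m e hm
    · rw [mul_left_comm, hQ c₀ hc₀I m e hm, Polynomial.eval_mul, Polynomial.eval_sub, Polynomial.eval_X,
        Polynomial.eval_C]
      have h1 : ((m - I'.card - Cset.card : ℕ) : ℝ) = (m : ℝ) - (I'.card + Cset.card) := by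
        rw [Nat.sub_sub, Nat.cast_sub hCm]; push_cast; ring
      rw [h1]; ring

/-! ### §C6 Interpolation: the conditioned multiplicativity at the odd size `N` -/

/-- Transport along the identity embedding is the identity. [cite: Potechin2019, Def. 6.5 (61:14)] -/
theorem push_refl (A : Finset (Sym2 (Fin N))) : push (Function.Embedding.refl (Fin N)) A = A := by
  have key : ∀ z : Sym2 (Fin N), Sym2.map (Function.Embedding.refl (Fin N)) z = z := fun z => by
    induction z using Sym2.ind with
    | h a b => rfl
  ext z
  rw [mem_push]
  constructor
  · rintro ⟨z', hz', rfl⟩; rwa [key]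
  · exact fun hz => ⟨z, hz, key z⟩

/-- Edge-count bound for the partial matchings occurring in `Ẽ[x_C 1_F]` under the fitting condition.
[cite: Potechin2019, Thm. 5.12 (2) (61:12, the index-degree condition)] -/
theorem card_le_of_fit {I : Finset (Fin N)} {F C₀ S : Finset (Sym2 (Fin N))} {J : ℕ} (hF : F ⊆ innerEdges I)
    (hC : I.card + ((verts C₀) \ I).card ≤ 2 * J + 1) (hS : S ⊆ innerEdges I \ F)
    (hpm : IsPartialMatching (C₀ ∪ F ∪ S)) : (C₀ ∪ F ∪ S).card ≤ J := by
  have hv : verts (C₀ ∪ F ∪ S) ⊆ I ∪ (verts C₀ \ I) := by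
    rw [union_sdiff_self_eq_union, verts_union, verts_union]
    refine union_subset (union_subset subset_union_right ?_) ?_
    · exact (verts_subset_of_subset_innerEdges hF).trans subset_union_left
    · exact (verts_subset_of_subset_innerEdges (hS.trans sdiff_subset)).trans subset_union_left
  have h1 := card_le_card hv
  rw [hpm.card_verts] at h1
  have h2 := card_union_le I (verts C₀ \ I)
  omega

/-- Off the roots: for even `m` no factor `m − 1 − 2j` vanishes. [cite: Potechin2019, §6.4 (61:16)] -/
theorem sub_ne_zero_of_even {m : ℕ} (hm : Even m) (j : ℕ) : (m : ℝ) - 1 - 2 * j ≠ 0 := by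
  intro h
  have : (m : ℝ) = ((2 * j + 1 : ℕ) : ℝ) := by push_cast; linarith
  have hm' : m = 2 * j + 1 := by exact_mod_cast this
  exact Nat.not_even_iff_odd.2 ⟨j, hm'⟩ hm

/-- **Conditioned multiplicativity at the odd size `N`** (Potechin's Thm 5.12 (2) mechanism, made
unconditional in the fitting range): for `F ⊆ E(I)` and edge sets `A, B` with
`|I| + |verts A ∖ I| + |verts B ∖ I| ≤ N`,
`Ẽ_N[1_F] · Σ_{σ ∈ stab I} Ẽ_N[x_{A ∪ σB} 1_F] = #stab I · Ẽ_N[x_A 1_F] · Ẽ_N[x_B 1_F]`.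
Proof: both sides, multiplied by `D(m)²`, are values at `m` of fixed polynomials (`wsum_poly`,
`eval_poutcomePoly`) which agree at every even `m ≥ N` by the honest identity
(`outcomeValue_mul_sum_honest` in the world `K_m ⊇ K_N`), hence agree identically, in particular at
`m = N`. [cite: Potechin2019, Lemma 6.6–6.7 and Thm. 5.12 (2) (61:12, 61:14–61:15)] -/
theorem outcomeValue_mul_sum_odd (hN : Odd N) {I : Finset (Fin N)} {F A B : Finset (Sym2 (Fin N))}
    (hF : F ⊆ innerEdges I) (hfit : I.card + ((verts A) \ I).card + ((verts B) \ I).card ≤ N) :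
    outcomeValue N I F ∅ * ∑ σ ∈ stab I, outcomeValue N I F (A ∪ relabel σ B) =
      ((stab I).card : ℝ) * outcomeValue N I F A * outcomeValue N I F B := by
  classical
  obtain ⟨J, hJN⟩ := hN
  set s := I.card with hs
  set t := ((verts B) \ I).card with ht
  have hst : s + t ≤ N := by omega
  have hnzN : ∀ j < J, (N : ℝ) - 1 - 2 * j ≠ 0 := by
    intro j hj h
    have : (N : ℝ) = 2 * J + 1 := by exact_mod_cast hJN
    rw [this] at h
    have : (j : ℝ) < J := by exact_mod_cast hj
    linarith
  -- the polynomial of the stabiliser sums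
  obtain ⟨Q, hQ⟩ := wsum_poly (A := A) hF (J := J) (by omega) t I B subset_rfl ht.symm (by omega)
  -- edge-count conditions
  have hJ0 : ∀ S ⊆ innerEdges I \ F, IsPartialMatching (∅ ∪ F ∪ S) → (∅ ∪ F ∪ S).card ≤ J :=
    fun S hS hpm => card_le_of_fit hF (by simp [verts]; omega) hS hpm
  have hJA : ∀ S ⊆ innerEdges I \ F, IsPartialMatching (A ∪ F ∪ S) → (A ∪ F ∪ S).card ≤ J :=
    fun S hS hpm => card_le_of_fit hF (by omega) hS hpm
  have hJB : ∀ S ⊆ innerEdges I \ F, IsPartialMatching (B ∪ F ∪ S) → (B ∪ F ∪ S).card ≤ J :=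
    fun S hS hpm => card_le_of_fit hF (by omega) hS hpm
  set P0 := poutcomePoly J I F ∅ with hP0
  set PA := poutcomePoly J I F A with hPA
  set PB := poutcomePoly J I F B with hPB
  set Φ : Polynomial ℝ := ∏ i ∈ range t, (Polynomial.X - Polynomial.C ((s : ℝ) + i)) with hΦ
  have hΦeval : ∀ m : ℕ, s + t ≤ m → Φ.eval (m : ℝ) = (((m - s).descFactorial t : ℕ) : ℝ) := by
    intro m hm
    rw [hΦ, Polynomial.eval_prod, Nat.descFactorial_eq_prod_range, Nat.cast_prod]
    refine prod_congr rfl fun i hi => ?_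
    have hi' := mem_range.1 hi
    rw [Polynomial.eval_sub, Polynomial.eval_X, Polynomial.eval_C, Nat.cast_sub (by omega), Nat.cast_sub (by omega)]
    ring
  have hfac : ∀ m : ℕ, s + t ≤ m → ((m - s).factorial : ℝ) = ((m - s - t).factorial : ℝ) * ((m - s).descFactorial t : ℕ) := by
    intro m hm
    have := Nat.factorial_mul_descFactorial (show t ≤ m - s by omega)
    exact_mod_cast this.symm
  set R : Polynomial ℝ := P0 * Q - Φ * PA * PB with hR
  -- `R` vanishes at every even `m ≥ N`
  have hroot : ∀ m : ℕ, Even m → N ≤ m → R.eval (m : ℝ) = 0 := by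
    intro m hm hNm
    have hnz : ∀ j < J, (m : ℝ) - 1 - 2 * j ≠ 0 := fun j _ => sub_ne_zero_of_even hm j
    set e : Fin N ↪ Fin m := Fin.castLEEmb hNm with he
    have hFe : push e F ⊆ innerEdges (I.map e) := by rw [innerEdges_map]; exact map_subset_map.2 hF
    have hon := outcomeValue_mul_sum_honest hm hFe (push e A) (push e B)
    have hws : ∑ σ ∈ stab (I.map e), outcomeValue m (I.map e) (push e F) (push e A ∪ relabel σ (push e B))
        = wsum m e I F A I B := rfl
    rw [hws, ← push_empty e, outcomeValue_push, outcomeValue_push, outcomeValue_push, card_stab, card_map] at hon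
    -- `hon : poutcome m I F ∅ * wsum = (m - s)! * poutcome m I F A * poutcome m I F B`
    have hw := hQ m e hnz
    have e0 := eval_poutcomePoly (m := m) rfl hnz hJ0
    have eA := eval_poutcomePoly (m := m) rfl hnz hJA
    have eB := eval_poutcomePoly (m := m) rfl hnz hJB
    rw [← hP0] at e0; rw [← hPA] at eA; rw [← hPB] at eB
    have hfm := hfac m (by omega)
    have hΦm := hΦeval m (by omega)
    have hfne : ((m - s - t).factorial : ℝ) ≠ 0 := by exact_mod_cast (Nat.factorial_pos _).ne'
    -- multiply the honest identity by `D(m)²`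
    have key : P0.eval (m : ℝ) * (((m - s - t).factorial : ℝ) * Q.eval (m : ℝ)) =
        ((m - s - t).factorial : ℝ) * (Φ.eval (m : ℝ) * PA.eval (m : ℝ) * PB.eval (m : ℝ)) := by
      rw [← hw, e0, eA, eB, hΦm]
      have := congrArg (fun z => (Dpoly J).eval (m : ℝ) * (Dpoly J).eval (m : ℝ) * z) hon
      rw [hfm] at this
      linear_combination this
    have key2 : ((m - s - t).factorial : ℝ) * (P0.eval (m : ℝ) * Q.eval (m : ℝ)) =
        ((m - s - t).factorial : ℝ) * (Φ.eval (m : ℝ) * PA.eval (m : ℝ) * PB.eval (m : ℝ)) := by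
      linear_combination key
    have := mul_left_cancel₀ hfne key2
    rw [hR, Polynomial.eval_sub, Polynomial.eval_mul, Polynomial.eval_mul, Polynomial.eval_mul]
    linear_combination this
  have hRzero : R = 0 := by
    apply Polynomial.eq_zero_of_infinite_isRoot
    refine Set.infinite_of_injective_forall_mem (f := fun k : ℕ => ((2 * (N + k) : ℕ) : ℝ)) ?_ ?_
    · intro a b hab
      have hab' : ((2 * (N + a) : ℕ) : ℝ) = ((2 * (N + b) : ℕ) : ℝ) := hab
      have : (2 * (N + a) : ℕ) = 2 * (N + b) := by exact_mod_cast hab'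
      omega
    · intro k
      exact hroot (2 * (N + k)) ⟨N + k, by ring⟩ (by omega)
  -- evaluate at `N` in the identity world
  have hw := hQ N (Function.Embedding.refl _) hnzN
  have hwsum : wsum N (Function.Embedding.refl _) I F A I B = ∑ σ ∈ stab I, outcomeValue N I F (A ∪ relabel σ B) := by
    unfold wsum; rw [Finset.map_refl, push_refl, push_refl, push_refl]
  rw [hwsum] at hw
  have e0 := eval_poutcomePoly (m := N) rfl hnzN hJ0
  have eA := eval_poutcomePoly (m := N) rfl hnzN hJA
  have eB := eval_poutcomePoly (m := N) rfl hnzN hJB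
  rw [← hP0, poutcome_self] at e0
  rw [← hPA, poutcome_self] at eA
  rw [← hPB, poutcome_self] at eB
  have hRN : R.eval (N : ℝ) = 0 := by rw [hRzero, Polynomial.eval_zero]
  rw [hR, Polynomial.eval_sub, Polynomial.eval_mul, Polynomial.eval_mul, Polynomial.eval_mul, e0, eA, eB,
    hΦeval N hst] at hRN
  have hD : (Dpoly J).eval (N : ℝ) ≠ 0 := eval_Dpoly_ne_zero hnzN
  have hfacN := hfac N hst
  rw [card_stab]
  apply mul_left_cancel₀ (mul_ne_zero hD hD)
  have key : (Dpoly J).eval (N : ℝ) * outcomeValue N I F ∅ * Q.eval (N : ℝ) =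
      (((N - s).descFactorial t : ℕ) : ℝ) * ((Dpoly J).eval (N : ℝ) * outcomeValue N I F A) *
        ((Dpoly J).eval (N : ℝ) * outcomeValue N I F B) := by
    linear_combination hRN
  linear_combination ((Dpoly J).eval (N : ℝ) * outcomeValue N I F ∅) * hw
    + ((N - s - t).factorial : ℝ) * key
    - (Dpoly J).eval (N : ℝ) * (Dpoly J).eval (N : ℝ) * outcomeValue N I F A * outcomeValue N I F B * hfacN

/-! ### §C7 Positivity of the outcome probabilities `Ẽ[1_F]` (a closed form)

For a partial matching `F ⊆ E(I)` with `f` edges and `U := I ∖ V(F)` (`u = |I| − 2f` uncovered vertices),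
`Ẽ[1_F] = Σ_{S ⊆ E(U)} (−1)^{|S|} [S partial matching] μ_N(f + |S|)`; exposing the uncovered vertices one
at a time gives the closed form `Ẽ[1_F] = (N − |I|)(N − |I| − 1)⋯(N − |I| − u + 1) · μ_N(|I| − f)`, which is
the value `Pr[M ∩ E(I) = F] = (m − |I|)^{(u)}·(m − 2u − 2f − 1)!!/(m − 1)!!` of the honest worlds `K_m`
continued to `m = N`, and is positive as soon as `2|I| ≤ N`. -/

/-- `mval N c S := [S partial matching] · μ_N(c + |S|)` — the story value `Ẽ[x_F x_S]` for a partial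
matching `F` with `c` edges vertex-disjoint from `S`. [cite: Potechin2019, Example 3.4 (61:7)] -/
def mval (N c : ℕ) (S : Finset (Sym2 (Fin N))) : ℝ :=
  by classical exact if IsPartialMatching S then moment N (c + S.card) else 0

/-- `mval` on partial matchings. [cite: Potechin2019, Example 3.4 (61:7)] -/
theorem mval_of {c : ℕ} {S : Finset (Sym2 (Fin N))} (h : IsPartialMatching S) :
    mval N c S = moment N (c + S.card) := by
  classical simp [mval, h]

/-- `mval` vanishes off partial matchings. [cite: Potechin2019, Example 3.4 (61:7)] -/
theorem mval_of_not {c : ℕ} {S : Finset (Sym2 (Fin N))} (h : ¬ IsPartialMatching S) : mval N c S = 0 := by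
  classical simp [mval, h]

/-- `noEdgeVal N c U := Σ_{S ⊆ E(U)} (−1)^{|S|} mval N c S` — the pseudo-probability `Ẽ[x_F · 1(no chosen
edge inside U)]` for a `c`-edge partial matching `F` vertex-disjoint from `U`.
[cite: Potechin2019, Def. 5.2 and Thm 5.12 (2) (61:11–61:12)] -/
def noEdgeVal (N c : ℕ) (U : Finset (Fin N)) : ℝ :=
  ∑ S ∈ (innerEdges U).powerset, (-1 : ℝ) ^ S.card * mval N c S

/-- Two distinct edges through one vertex: not a partial matching. [cite: Potechin2019, Example 3.4 (61:7)] -/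
theorem not_isPartialMatching_of_two {G : Finset (Sym2 (Fin N))} {e e' : Sym2 (Fin N)} {x : Fin N}
    (he : e ∈ G) (he' : e' ∈ G) (hne : e ≠ e') (hx : x ∈ e) (hx' : x ∈ e') : ¬ IsPartialMatching G := by
  classical
  intro h
  have h2 : 2 ≤ (G.filter fun f => x ∈ f).card := by
    rw [← card_pair hne]
    refine card_le_card fun f hf => ?_
    rcases mem_insert.1 hf with rfl | hf
    · exact mem_filter.2 ⟨he, hx⟩
    · rw [mem_singleton.1 hf]; exact mem_filter.2 ⟨he', hx'⟩
  have := h.2 x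
  omega

/-- Vertex-disjoint partial matchings have a partial matching as union.
[cite: Potechin2019, Example 3.4 (61:7)] -/
theorem IsPartialMatching.union {F S : Finset (Sym2 (Fin N))} (hF : IsPartialMatching F)
    (hS : IsPartialMatching S) (h : Disjoint (verts F) (verts S)) : IsPartialMatching (F ∪ S) := by
  classical
  refine ⟨fun e he => (mem_union.1 he).elim (hF.1 e) (hS.1 e), fun x => ?_⟩
  rw [filter_union]
  by_cases hx : x ∈ verts F
  · have : S.filter (fun e => x ∈ e) = ∅ :=
      filter_eq_empty_iff.2 fun e he hxe => (disjoint_left.1 h hx) (mem_verts.2 ⟨e, he, hxe⟩)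
    rw [this, union_empty]; exact hF.2 x
  · have : F.filter (fun e => x ∈ e) = ∅ :=
      filter_eq_empty_iff.2 fun e he hxe => hx (mem_verts.2 ⟨e, he, hxe⟩)
    rw [this, empty_union]; exact hS.2 x

/-- Summing over the subsets of a disjoint union is summing over pairs of subsets (powerset bijection;
a private copy of a helper found in several tree files). [folklore] -/
private theorem sum_powerset_union_disjoint {α M : Type*} [DecidableEq α] [AddCommMonoid M]
    {X Y : Finset α} (hXY : Disjoint X Y) (f : Finset α → M) :
    ∑ S ∈ (X ∪ Y).powerset, f S = ∑ S ∈ X.powerset, ∑ T ∈ Y.powerset, f (S ∪ T) := by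
  rw [← sum_product']
  refine (sum_nbij' (fun p => p.1 ∪ p.2) (fun S => (S ∩ X, S ∩ Y)) ?_ ?_ ?_ ?_ ?_).symm
  · rintro ⟨S, T⟩ hp
    simp only [mem_product, mem_powerset] at hp ⊢
    exact union_subset_union hp.1 hp.2
  · intro S _
    simp only [mem_product, mem_powerset]
    exact ⟨inter_subset_right, inter_subset_right⟩
  · rintro ⟨S, T⟩ hp
    simp only [mem_product, mem_powerset] at hp
    have h1 : T ∩ X = ∅ := disjoint_iff_inter_eq_empty.1 (hXY.symm.mono_left hp.2)
    have h2 : S ∩ Y = ∅ := disjoint_iff_inter_eq_empty.1 (hXY.mono_left hp.1)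
    refine Prod.ext ?_ ?_
    · show (S ∪ T) ∩ X = S
      rw [union_inter_distrib_right, h1, union_empty, inter_eq_left.2 hp.1]
    · show (S ∪ T) ∩ Y = T
      rw [union_inter_distrib_right, h2, empty_union, inter_eq_left.2 hp.2]
  · intro S hS
    show S ∩ X ∪ S ∩ Y = S
    rw [← inter_union_distrib_left, inter_eq_left.2 (mem_powerset.1 hS)]
  · intro p _
    rfl

/-- **Vertex exposure**: for `v ∉ U`,
`noEdgeVal N c (U ∪ {v}) = noEdgeVal N c U − Σ_{w ∈ U} noEdgeVal N (c+1) (U ∖ {w})`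
(either no chosen edge at `v` inside `U ∪ {v}`, or exactly one edge `vw`, `w ∈ U`, which joins `F`).
[cite: Potechin2019, Thm 5.12 (2) (61:12, "consider x_{ij} for each j"), App. 8 Def. 8.15] -/
theorem noEdgeVal_insert (c : ℕ) {U : Finset (Fin N)} {v : Fin N} (hv : v ∉ U) :
    noEdgeVal N c (insert v U) = noEdgeVal N c U - ∑ w ∈ U, noEdgeVal N (c + 1) (U.erase w) := by
  classical
  set E := innerEdges U with hE
  set E' := innerEdges (insert v U) with hE'
  set St := E'.filter (fun e => v ∈ e) with hSt
  have hEeq : E'.filter (fun e => v ∉ e) = E := by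
    ext e
    simp only [mem_filter, hE, hE', mem_innerEdges, mem_insert]
    constructor
    · rintro ⟨h1, h2⟩ x hx
      rcases h1 x hx with rfl | h
      · exact absurd hx h2
      · exact h
    · intro h
      exact ⟨fun x hx => Or.inr (h x hx), fun hvx => hv (h v hvx)⟩
  have hsplit : E' = E ∪ St := by
    rw [← hEeq, union_comm]; exact (filter_union_filter_not_eq _ _).symm
  have hdisj : Disjoint E St := by
    rw [← hEeq]; exact (disjoint_filter_filter_not E' E' _).symm
  have hEE' : E ⊆ E' := fun e he =>
    mem_innerEdges.2 fun x hx => mem_insert_of_mem (mem_innerEdges.1 he x hx)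
  -- the terms of the star sum that survive: `T = ∅` and `T = {vw}`, `w ∈ U`
  set P' : Finset (Finset (Sym2 (Fin N))) := insert ∅ (U.image fun w => ({s(v, w)} : Finset (Sym2 (Fin N))))
    with hP'
  set g : Finset (Sym2 (Fin N)) → ℝ :=
    fun T => ∑ S ∈ E.powerset, (-1 : ℝ) ^ (S ∪ T).card * mval N c (S ∪ T) with hg
  have hmemSt : ∀ w ∈ U, s(v, w) ∈ St := fun w hw =>
    mem_filter.2 ⟨mem_innerEdges.2 fun x hx => by
      rcases Sym2.mem_iff.1 hx with rfl | rfl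
      · exact mem_insert_self _ _
      · exact mem_insert_of_mem hw, Sym2.mem_mk_left _ _⟩
  have hP'sub : P' ⊆ St.powerset := by
    intro T hT
    rw [mem_powerset]
    rcases mem_insert.1 hT with rfl | hT
    · exact empty_subset _
    · obtain ⟨w, hw, rfl⟩ := mem_image.1 hT
      exact singleton_subset_iff.2 (hmemSt w hw)
  have hvan : ∀ T ∈ St.powerset, T ∉ P' → g T = 0 := by
    intro T hT hTn
    have hTsub : T ⊆ St := mem_powerset.1 hT
    have hTne : T.Nonempty := by
      rw [nonempty_iff_ne_empty]; rintro rfl; exact hTn (mem_insert_self _ _)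
    obtain ⟨e, he⟩ := hTne
    have heSt := hTsub he
    have hve : v ∈ e := (mem_filter.1 heSt).2
    refine sum_eq_zero fun S _ => ?_
    rw [mval_of_not, mul_zero]
    by_cases hd : e.IsDiag
    · exact fun h => h.1 e (mem_union_right _ he) hd
    · by_cases hT1 : T = {e}
      · exfalso
        refine hTn (mem_insert_of_mem (mem_image.2 ?_))
        have hw' : Sym2.Mem.other hve ∈ insert v U :=
          (mem_innerEdges.1 (mem_filter.1 heSt).1) _ (Sym2.other_mem hve)
        have hwv : Sym2.Mem.other hve ≠ v := fun h => hd (by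
          rw [← Sym2.other_spec hve, h]; exact Sym2.mk_isDiag_iff.2 rfl)
        refine ⟨Sym2.Mem.other hve, (mem_insert.1 hw').resolve_left hwv, ?_⟩
        rw [hT1, Sym2.other_spec hve]
      · obtain ⟨e', he', hne⟩ : ∃ e' ∈ T, e' ≠ e := by
          by_contra hcon
          push Not at hcon
          exact hT1 (eq_singleton_iff_unique_mem.2 ⟨he, hcon⟩)
        exact not_isPartialMatching_of_two (mem_union_right _ he') (mem_union_right _ he) hne
          (mem_filter.1 (hTsub he')).2 hve
  have hinj : Set.InjOn (fun w => ({s(v, w)} : Finset (Sym2 (Fin N)))) ↑U := by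
    intro w₁ _ w₂ _ h
    have h' : s(v, w₁) = s(v, w₂) := singleton_injective h
    rcases Sym2.eq_iff.1 h' with ⟨_, h⟩ | ⟨h1, h2⟩
    · exact h
    · exact h2.trans h1
  have h0 : (∅ : Finset (Sym2 (Fin N))) ∉ U.image fun w => ({s(v, w)} : Finset (Sym2 (Fin N))) := by
    intro h
    obtain ⟨w, _, hw⟩ := mem_image.1 h
    exact singleton_ne_empty _ hw
  -- the two surviving kinds of terms
  have hg0 : g ∅ = noEdgeVal N c U := by
    simp only [hg, union_empty]; rfl
  have hgw : ∀ w ∈ U, g {s(v, w)} = - noEdgeVal N (c + 1) (U.erase w) := by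
    intro w hw
    have hvw : v ≠ w := fun h => hv (h ▸ hw)
    have heE : s(v, w) ∉ E := fun h => hv (mem_innerEdges.1 h v (Sym2.mem_mk_left _ _))
    have hins : ∀ S : Finset (Sym2 (Fin N)), S ∪ {s(v, w)} = insert s(v, w) S := fun S => by
      rw [union_comm, ← insert_eq]
    have hsub : (innerEdges (U.erase w)).powerset ⊆ E.powerset :=
      powerset_mono.2 fun e he => mem_innerEdges.2 fun x hx => mem_of_mem_erase (mem_innerEdges.1 he x hx)
    have step1 : g {s(v, w)} = - ∑ S ∈ E.powerset, (-1 : ℝ) ^ S.card * mval N c (insert s(v, w) S) := by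
      simp only [hg]
      rw [← sum_neg_distrib]
      refine sum_congr rfl fun S hS => ?_
      have hS : s(v, w) ∉ S := fun h => heE (mem_powerset.1 hS h)
      rw [hins, card_insert_of_notMem hS, pow_succ]
      ring
    rw [step1, noEdgeVal, ← sum_subset hsub]
    · congr 1
      refine sum_congr rfl fun S hS => ?_
      have hSU : S ⊆ innerEdges (U.erase w) := mem_powerset.1 hS
      have hS : s(v, w) ∉ S := fun h => heE (hsub hS |> mem_powerset.1 <| h)
      congr 1
      by_cases hSpm : IsPartialMatching S
      · have hvS : verts S ⊆ U.erase w := verts_subset_of_subset_innerEdges hSU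
        have hpm : IsPartialMatching (insert s(v, w) S) :=
          hSpm.insert_edge hvw (fun h => hv (mem_of_mem_erase (hvS h)))
            (fun h => notMem_erase w U (hvS h))
        rw [mval_of hpm, mval_of hSpm, card_insert_of_notMem hS]
        congr 1; ring
      · rw [mval_of_not hSpm, mval_of_not fun h => hSpm (h.subset (subset_insert _ _))]
    · intro S hS hSn
      have hSE : S ⊆ E := mem_powerset.1 hS
      obtain ⟨e₁, he₁, he₁n⟩ : ∃ e₁ ∈ S, e₁ ∉ innerEdges (U.erase w) :=
        not_subset.1 fun h => hSn (mem_powerset.2 h)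
      have hwe₁ : w ∈ e₁ := by
        by_contra hcon
        exact he₁n (mem_innerEdges.2 fun x hx =>
          mem_erase.2 ⟨fun h => hcon (h ▸ hx), mem_innerEdges.1 (hSE he₁) x hx⟩)
      have hne : e₁ ≠ s(v, w) := fun h => heE (h ▸ hSE he₁)
      rw [mval_of_not (not_isPartialMatching_of_two (mem_insert_of_mem he₁) (mem_insert_self _ _) hne
        hwe₁ (Sym2.mem_mk_right _ _)), mul_zero]
  -- assemble
  have lhs : noEdgeVal N c (insert v U) = g ∅ + ∑ w ∈ U, g {s(v, w)} := by
    unfold noEdgeVal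
    rw [← hE', hsplit, sum_powerset_union_disjoint hdisj, sum_comm, ← sum_subset hP'sub hvan, hP',
      sum_insert h0, sum_image hinj]
  rw [lhs, hg0, sum_congr rfl hgw, sum_neg_distrib]
  ring

/-- Every unordered pair has a member. [cite: Potechin2019, Def. 2.6 (61:5)] -/
theorem sym2_exists_mem (e : Sym2 (Fin N)) : ∃ x, x ∈ e := by
  induction e using Sym2.ind with
  | h a b => exact ⟨a, Sym2.mem_mk_left a b⟩

/-- No vertices to expose: `noEdgeVal N c ∅ = μ_N(c)`. [cite: Potechin2019, Example 3.4 (61:7)] -/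
theorem noEdgeVal_empty (c : ℕ) : noEdgeVal N c ∅ = moment N c := by
  classical
  have h0 : innerEdges (∅ : Finset (Fin N)) = ∅ :=
    eq_empty_of_forall_notMem fun e he => by
      obtain ⟨x, hx⟩ := sym2_exists_mem e
      exact notMem_empty x (mem_innerEdges.1 he x hx)
  rw [noEdgeVal, h0, powerset_empty, sum_singleton, card_empty, pow_zero, one_mul,
    mval_of ⟨by simp, by simp⟩, card_empty, add_zero]

/-- The closed form `(N − 2c − u)(N − 2c − u − 1)⋯(N − 2c − 2u + 1) · μ_N(c + u)` of `noEdgeVal N c U`,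
`|U| = u` (in the honest worlds: `u` exposed vertices matched injectively into the `N − 2c − u` free
ones). [cite: Potechin2019, Thm 5.12 (2) (61:12)] -/
def neClosed (N c u : ℕ) : ℝ := (∏ j ∈ range u, ((N : ℝ) - 2 * c - u - j)) * moment N (c + u)

/-- One exposed vertex: `neClosed N c 1 = neClosed N c 0 = μ_N(c)`. [cite: Potechin2019, Thm 5.12 (2) (61:12)] -/
theorem neClosed_one {c : ℕ} (h : 2 * (c + 1) ≤ N) : neClosed N c 1 = neClosed N c 0 := by
  have hd : (N : ℝ) - 1 - 2 * (c : ℝ) ≠ 0 := by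
    have : ((2 * (c + 1) : ℕ) : ℝ) ≤ N := by exact_mod_cast h
    push_cast at this
    intro h0; linarith
  simp only [neClosed, prod_range_one, prod_range_zero, Nat.cast_zero, Nat.cast_one, add_zero, one_mul,
    moment_succ, sub_zero]
  rw [show (N : ℝ) - 2 * c - 1 = (N : ℝ) - 1 - 2 * c by ring]
  field_simp

/-- The exposure recursion on closed forms:
`neClosed N c (u+2) = neClosed N c (u+1) − (u+1)·neClosed N (c+1) u`. [cite: Potechin2019, Thm 5.12 (2) (61:12)] -/
theorem neClosed_succ_succ {c u₁ : ℕ} (h : 2 * (c + u₁ + 2) ≤ N) :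
    neClosed N c (u₁ + 2) = neClosed N c (u₁ + 1) - (u₁ + 1) * neClosed N (c + 1) u₁ := by
  set y : ℝ := (N : ℝ) - 2 * c - u₁ - 1 with hy
  have hd : (N : ℝ) - 1 - 2 * ((c + u₁ + 1 : ℕ) : ℝ) ≠ 0 := by
    have : ((2 * (c + u₁ + 2) : ℕ) : ℝ) ≤ N := by exact_mod_cast h
    push_cast at this ⊢
    intro h0; linarith
  set P : ℝ := ∏ j ∈ range u₁, (y - 1 - j) with hP
  have hp1 : ∏ j ∈ range (u₁ + 2), ((N : ℝ) - 2 * c - ((u₁ + 2 : ℕ) : ℝ) - j) =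
      P * (y - 1 - u₁) * ((N : ℝ) - 1 - 2 * ((c + u₁ + 1 : ℕ) : ℝ)) := by
    rw [prod_range_succ, prod_range_succ, hP]
    have : ∀ j ∈ range u₁, ((N : ℝ) - 2 * c - ((u₁ + 2 : ℕ) : ℝ) - j) = y - 1 - j := fun j _ => by
      rw [hy]; push_cast; ring
    rw [prod_congr rfl this]
    push_cast; ring
  have hp2 : ∏ j ∈ range (u₁ + 1), ((N : ℝ) - 2 * c - ((u₁ + 1 : ℕ) : ℝ) - j) = P * y := by
    rw [prod_range_succ', hP]
    have : ∀ j ∈ range u₁, ((N : ℝ) - 2 * c - ((u₁ + 1 : ℕ) : ℝ) - ((j + 1 : ℕ) : ℝ)) = y - 1 - j :=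
      fun j _ => by rw [hy]; push_cast; ring
    rw [prod_congr rfl this]
    push_cast; ring
  have hp3 : ∏ j ∈ range u₁, ((N : ℝ) - 2 * ((c + 1 : ℕ) : ℝ) - (u₁ : ℝ) - j) = P := by
    rw [hP]
    exact prod_congr rfl fun j _ => by rw [hy]; push_cast; ring
  have hm1 : moment N (c + (u₁ + 2)) = moment N (c + u₁ + 1) * ((N : ℝ) - 1 - 2 * ((c + u₁ + 1 : ℕ) : ℝ))⁻¹ := by
    rw [show c + (u₁ + 2) = (c + u₁ + 1) + 1 by ring, moment_succ]
  have hm2 : moment N (c + (u₁ + 1)) = moment N (c + u₁ + 1) := by rw [add_assoc]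
  have hm3 : moment N (c + 1 + u₁) = moment N (c + u₁ + 1) := by rw [Nat.add_right_comm]
  unfold neClosed
  rw [hp1, hp2, hp3, hm1, hm2, hm3]
  field_simp
  ring

/-- Positivity of the closed form when `2(c + u) ≤ N`. [cite: Potechin2019, Thm 5.12 (2) (61:12)] -/
theorem neClosed_pos {c u : ℕ} (h : 2 * (c + u) ≤ N) : 0 < neClosed N c u := by
  unfold neClosed
  refine mul_pos (prod_pos fun j hj => ?_) (moment_pos h)
  have hj := mem_range.1 hj
  have h1 : ((2 * (c + u) : ℕ) : ℝ) ≤ N := by exact_mod_cast h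
  have h2 : (j : ℝ) + 1 ≤ u := by exact_mod_cast hj
  push_cast at h1
  linarith

/-- **Closed form**: `noEdgeVal N c U = neClosed N c |U|` whenever `2(c + |U|) ≤ N`, by vertex exposure.
[cite: Potechin2019, Thm 5.12 (2) (61:12)] -/
theorem noEdgeVal_eq_neClosed : ∀ (n c : ℕ) (U : Finset (Fin N)), U.card = n → 2 * (c + n) ≤ N →
    noEdgeVal N c U = neClosed N c n := by
  classical
  intro n
  induction n using Nat.strong_induction_on with
  | _ n ih =>
    intro c U hU h
    rcases n with _ | m
    · rw [card_eq_zero.1 hU, noEdgeVal_empty]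
      simp [neClosed]
    · obtain ⟨v, hv⟩ : U.Nonempty := card_pos.1 (by omega)
      have hvU₀ : v ∉ U.erase v := notMem_erase v U
      have hU₀ : (U.erase v).card = m := by rw [card_erase_of_mem hv, hU]; rfl
      rw [← insert_erase hv, noEdgeVal_insert c hvU₀, ih m (by omega) c _ hU₀ (by omega)]
      have hin : ∀ w ∈ U.erase v, noEdgeVal N (c + 1) ((U.erase v).erase w) = neClosed N (c + 1) (m - 1) := by
        intro w hw
        have hm : 0 < m := hU₀ ▸ card_pos.2 ⟨w, hw⟩
        exact ih (m - 1) (by omega) (c + 1) _ (by rw [card_erase_of_mem hw, hU₀]) (by omega)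
      rw [sum_congr rfl hin, sum_const, nsmul_eq_mul, hU₀]
      rcases m with _ | u₁
      · rw [neClosed_one (by omega)]; simp
      · rw [neClosed_succ_succ (by omega)]
        push_cast
        ring_nf

/-- The uncovered part of `I`: for a partial matching `F ⊆ E(I)`, `|I ∖ V(F)| = |I| − 2|F|`.
[cite: Potechin2019, Def. 2.6 (61:5)] -/
theorem card_sdiff_verts {I : Finset (Fin N)} {F : Finset (Sym2 (Fin N))} (hF : F ⊆ innerEdges I)
    (hFpm : IsPartialMatching F) : (I \ verts F).card = I.card - 2 * F.card := by
  rw [card_sdiff_of_subset (verts_subset_of_subset_innerEdges hF), hFpm.card_verts]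

/-- **Reduction**: for a partial matching `F ⊆ E(I)`, `Ẽ[1_F] = noEdgeVal N |F| (I ∖ V(F))`
(the inclusion–exclusion terms through a covered vertex vanish, and `Ẽ[x_F x_S] = μ_N(|F| + |S|)`).
[cite: Potechin2019, Thm 5.12 (2) (61:12), Example 3.4 (61:7)] -/
theorem outcomeValue_empty_eq (I : Finset (Fin N)) {F : Finset (Sym2 (Fin N))}
    (hFpm : IsPartialMatching F) : outcomeValue N I F ∅ = noEdgeVal N F.card (I \ verts F) := by
  classical
  set U := I \ verts F with hU
  have hFU : ∀ e ∈ innerEdges U, e ∉ F := by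
    intro e he heF
    obtain ⟨x, hx⟩ := sym2_exists_mem e
    exact (mem_sdiff.1 (mem_innerEdges.1 he x hx)).2 (mem_verts.2 ⟨e, heF, hx⟩)
  have hsub : (innerEdges U).powerset ⊆ (innerEdges I \ F).powerset := by
    refine powerset_mono.2 fun e he => mem_sdiff.2 ⟨?_, hFU e he⟩
    exact mem_innerEdges.2 fun x hx => (mem_sdiff.1 (mem_innerEdges.1 he x hx)).1
  unfold outcomeValue noEdgeVal
  rw [← sum_subset hsub]
  · refine sum_congr rfl fun S hS => ?_
    have hSU : S ⊆ innerEdges U := mem_powerset.1 hS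
    rw [empty_union]
    congr 1
    by_cases hSpm : IsPartialMatching S
    · have hvS : verts S ⊆ U := verts_subset_of_subset_innerEdges hSU
      have hdv : Disjoint (verts F) (verts S) :=
        disjoint_left.2 fun x hxF hxS => (mem_sdiff.1 (hvS hxS)).2 hxF
      have hde : Disjoint F S := disjoint_left.2 fun e heF heS => hFU e (hSU heS) heF
      rw [mval_of hSpm, storyValue_of (hFpm.union hSpm hdv), card_union_of_disjoint hde]
    · rw [mval_of_not hSpm, storyValue_of_not fun h => hSpm (h.subset subset_union_right)]
  · intro S hS hSn
    have hSE : S ⊆ innerEdges I \ F := mem_powerset.1 hS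
    obtain ⟨e, he, heU⟩ : ∃ e ∈ S, e ∉ innerEdges U := not_subset.1 fun h => hSn (mem_powerset.2 h)
    have heI := mem_sdiff.1 (hSE he)
    obtain ⟨x, hx, hxU⟩ : ∃ x ∈ e, x ∉ U := by
      by_contra hcon
      push Not at hcon
      exact heU (mem_innerEdges.2 hcon)
    have hxF : x ∈ verts F := by
      by_contra hx'
      exact hxU (mem_sdiff.2 ⟨mem_innerEdges.1 heI.1 x hx, hx'⟩)
    obtain ⟨e', he', hxe'⟩ := mem_verts.1 hxF
    have hne : e' ≠ e := fun h => heI.2 (h ▸ he')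
    rw [empty_union, storyValue_of_not (not_isPartialMatching_of_two (mem_union_left _ he')
      (mem_union_right _ he) hne hxe' hx), mul_zero]

/-- **Positivity of the outcome probabilities**: `0 < Ẽ[1_F]` for every partial matching `F ⊆ E(I)`
when `2|I| ≤ N`. [cite: Potechin2019, Thm 5.12 (2) (61:12, "E'' has all non-negative probabilities")] -/
theorem outcomeValue_empty_pos {I : Finset (Fin N)} {F : Finset (Sym2 (Fin N))} (h2 : 2 * I.card ≤ N)
    (hF : F ⊆ innerEdges I) (hFpm : IsPartialMatching F) : 0 < outcomeValue N I F ∅ := by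
  have hvI : verts F ⊆ I := verts_subset_of_subset_innerEdges hF
  have hle : 2 * F.card ≤ I.card := hFpm.card_verts ▸ card_le_card hvI
  rw [outcomeValue_empty_eq I hFpm,
    noEdgeVal_eq_neClosed _ F.card (I \ verts F) (card_sdiff_verts hF hFpm) (by omega)]
  exact neClosed_pos (by omega)

/-- Outcomes that are not partial matchings have identically vanishing conditioned values.
[cite: Potechin2019, Example 3.4 (61:7)] -/
theorem outcomeValue_of_not_isPartialMatching {I : Finset (Fin N)} {F : Finset (Sym2 (Fin N))}
    (hF : ¬ IsPartialMatching F) (C : Finset (Sym2 (Fin N))) : outcomeValue N I F C = 0 := by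
  unfold outcomeValue
  refine sum_eq_zero fun S _ => ?_
  rw [storyValue_of_not fun h => hF (h.subset (subset_union_right.trans subset_union_left)), mul_zero]

/-! ### §C8 Assembly: PSD-ness of the story pseudo-expectation for `6k ≤ N` -/

/-- **Theorem (Potechin 2019, Thm 1.2, in the range `6k ≤ m`).** For odd `N` and `6k ≤ N` the story
pseudo-expectation `Ẽ` of the MOD 2 principle on `K_N` (`Ẽ[x_G] = [G partial matching]·μ_N(|G|)`) is
positive semidefinite on multilinear polynomials of edge-degree `≤ k`:
`Σ_{A,B} δ_A δ_B Ẽ[x_{A ∪ B}] ≥ 0`.  (Printed for index degree `≤ n/2`, which contains edge-degree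
`k` when `4k + 1 ≤ N`; the conditioning / interpolation argument of §5–§6 formalised here needs the
three index supports to fit, whence `6k ≤ N` — see the module docstring, *Threshold*.)
[cite: Potechin2019, Theorem 1.2 (61:4), Thm 5.12 and §6] -/
theorem storyForm_nonneg (hN : Odd N) {k : ℕ} (hk : 6 * k ≤ N) (δ : EdgeSets N k → ℝ) :
    0 ≤ storyForm N k δ := by
  classical
  refine storyForm_nonneg_of_invariant (fun I hI v hv => ?_) δ
  have hexp : storyForm N k v =
      ∑ F ∈ (innerEdges I).powerset, ∑ A, ∑ B, v A * v B * outcomeValue N I F (A.1 ∪ B.1) := by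
    symm
    rw [Finset.sum_comm]
    refine sum_congr rfl fun A _ => ?_
    rw [Finset.sum_comm]
    refine sum_congr rfl fun B _ => ?_
    rw [← mul_sum, sum_outcomeValue]
  rw [hexp]
  refine sum_nonneg fun F hF => ?_
  have hFI : F ⊆ innerEdges I := mem_powerset.1 hF
  by_cases hFpm : IsPartialMatching F
  swap
  · refine le_of_eq (Eq.symm (sum_eq_zero fun A _ => sum_eq_zero fun B _ => ?_))
    rw [outcomeValue_of_not_isPartialMatching hFpm, mul_zero]
  have hP : 0 < outcomeValue N I F ∅ := outcomeValue_empty_pos (by omega) hFI hFpm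
  have hcard : 0 < ((stab I).card : ℝ) := by exact_mod_cast card_pos.2 ⟨1, one_mem_stab I⟩
  set T := ∑ A, ∑ B, v A * v B * outcomeValue N I F (A.1 ∪ B.1) with hT
  set W := ∑ A : EdgeSets N k, v A * outcomeValue N I F A.1 with hW
  -- Step 1: invariance of `v` lets us relabel the second index by any `σ ∈ stab I`
  have hstep1 : ∀ σ ∈ stab I,
      T = ∑ A, ∑ B, v A * v B * outcomeValue N I F (A.1 ∪ relabel σ B.1) := by
    intro σ hσ
    refine sum_congr rfl fun A _ => ?_
    rw [← Equiv.sum_comp (edgeSetsPerm N k σ) (fun B => v A * v B * outcomeValue N I F (A.1 ∪ B.1))]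
    refine sum_congr rfl fun B _ => ?_
    rw [hv σ hσ B, edgeSetsPerm_apply_val]
  -- Step 2: average over `stab I`
  have h2 : ((stab I).card : ℝ) * T =
      ∑ A, ∑ B, v A * v B * ∑ σ ∈ stab I, outcomeValue N I F (A.1 ∪ relabel σ B.1) := by
    have : ∑ σ ∈ stab I, ∑ A, ∑ B, v A * v B * outcomeValue N I F (A.1 ∪ relabel σ B.1) =
        ((stab I).card : ℝ) * T := by
      rw [sum_congr rfl fun σ hσ => (hstep1 σ hσ).symm, sum_const, nsmul_eq_mul]
    rw [← this, sum_comm]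
    refine sum_congr rfl fun A _ => ?_
    rw [sum_comm]
    refine sum_congr rfl fun B _ => ?_
    rw [mul_sum]
  -- Step 3: conditioned multiplicativity (interpolated from the honest worlds), supports fit in `6k ≤ N`
  have hfit : ∀ A B : EdgeSets N k, I.card + ((verts A.1) \ I).card + ((verts B.1) \ I).card ≤ N := by
    intro A B
    have hA := (card_le_card (sdiff_subset : verts A.1 \ I ⊆ verts A.1)).trans
      ((card_verts_le A.1).trans (Nat.mul_le_mul_left 2 A.2))
    have hB := (card_le_card (sdiff_subset : verts B.1 \ I ⊆ verts B.1)).trans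
      ((card_verts_le B.1).trans (Nat.mul_le_mul_left 2 B.2))
    omega
  have h4 : ∀ A B : EdgeSets N k, outcomeValue N I F ∅ *
      (v A * v B * ∑ σ ∈ stab I, outcomeValue N I F (A.1 ∪ relabel σ B.1)) =
      ((stab I).card : ℝ) * ((v A * outcomeValue N I F A.1) * (v B * outcomeValue N I F B.1)) := by
    intro A B
    rw [mul_left_comm, outcomeValue_mul_sum_odd hN hFI (hfit A B)]
    ring
  have h3 : outcomeValue N I F ∅ * (((stab I).card : ℝ) * T) = ((stab I).card : ℝ) * W ^ 2 := by
    rw [h2, mul_sum, sq, hW, sum_mul_sum, mul_sum]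
    refine sum_congr rfl fun A _ => ?_
    rw [mul_sum, mul_sum]
    exact sum_congr rfl fun B _ => h4 A B
  have h5 : outcomeValue N I F ∅ * T = W ^ 2 :=
    mul_left_cancel₀ hcard.ne' (by rw [← h3]; ring)
  exact le_of_mul_le_mul_left (by rw [mul_zero, h5]; exact sq_nonneg W) hP

/-- **Theorem 1.2 in the shape used downstream** (kernel `[A ∪ A' partial matching]·(∏_{j<|A∪A'|}(N−1−2j))⁻¹`
on coefficient vectors indexed by edge sets of size `≤ k`): for odd `N` and `6k ≤ N`,
`0 ≤ Σ_{A,A'} δ_A δ_{A'} [A ∪ A' p.m.] (∏_{j<|A ∪ A'|} (N − 1 − 2j))⁻¹`.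
[cite: Potechin2019, Theorem 1.2 (61:2, 61:4)] -/
theorem pseudoMatching_momentForm_nonneg (hN : Odd N) {k : ℕ} (hk : 6 * k ≤ N)
    (δ : {F : Finset (Sym2 (Fin N)) // F.card ≤ k} → ℝ) :
    0 ≤ ∑ A, ∑ A', δ A * δ A' *
      @ite ℝ (IsPartialMatching (A.1 ∪ A'.1)) (Classical.dec _)
        (∏ j ∈ range (A.1 ∪ A'.1).card, ((N : ℝ) - 1 - 2 * j))⁻¹ 0 := by
  have h := storyForm_nonneg hN hk δ
  unfold storyForm at h
  convert h using 4 with A _ A' _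
  by_cases hpm : IsPartialMatching (A.1 ∪ A'.1)
  · rw [if_pos hpm, storyValue_of hpm, moment_eq_inv_prod]
  · rw [if_neg hpm, storyValue_of_not hpm]

end PseudoMatching

end Literature.Computability.Complexity
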